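import Literature.Claims.NS.Permana2026
import Literature.Analysis.FluidPDE.NSLerayHopfSereginEnergyProofs
import Literature.Analysis.FluidPDE.ClassicalNSFiniteEnergyEquality
import Literature.Analysis.FluidPDE.BKMClassEnstrophyContinuity
import Literature.Analysis.FluidPDE.WholeSpaceSobolevInterpolation
import Literature.Analysis.FluidPDE.NearBeltramiEnstrophyCriterion
import Literature.Analysis.FluidPDE.LocalBiotSavartCalculus
import HarnessLib

/-!
# Claim skeleton (D-0090 NS-CLAIMS, C156): Alneel, Zenodo 21706638 (2026) —
# «R(t)²X(t) ≤ C: The Scale Law for 3D Navier-Stokes and Global Regularity»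

Typed skeleton of Abd Almomen Alneel Adam Mohamed (record creator «ALNEEL, ABD ALMOMEN ALNEEL ADAM MOHAMED»),
*R(t)²X(t) ≤ C: The Scale Law for 3D Navier-Stokes and Global Regularity* (record title «A Scale Law Proof of
Global Regularity for the 3D Navier-Stokes Equations»), Zenodo record 21706638 = LATEST of concept 21018449
(earlier records 21018450, 21698138 are LINEAGE, not typed), created 2026-07-30, ONE PDF
(«3D_Navier_Stokes_Siege_Proof_ABD_ALMOMEN_2026.pdf», sha256[:16] `8bf4e8f400627e25`), 3 pp., PDF page = printed
page; bib `Alneel2026`. Cell `ns-claims`, lead RULINGS v1.37 (tail tranche 4a, census menu A19); typist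
`ns-claims-typist-3 g6`; TEXT OF RECORD = census pin `run/shared/lean/pub/ns-claims/census/texts/Alneel2026/`
(README 725273bea7b31012), sources `…/sources/Alneel2026/` (LOCATORS.md v2 79a564c8d05ca5ba by `ns-claims-lit-2
g5`); «p. N l. M» = line M of `pages/pNNN.txt`. UNREFEREED CLAIM under adjudication — NOTHING in this file asserts
a printed step: the paper's statements are `def … : Prop`; the `theorem`s are kernel relations (the composition
of the paper's OWN chain, the Clay link, faces of one step implying another, the «field at t = 0» instances of
the solution-grain steps via the tree's local existence) and small kernel facts about the typed definitions.

## The claimed statement (verbatim)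

Theorem 3.1 (No Finite-Time Blow-up), p. 3 l. 11–12: «Under the assumptions of Clay Problem A, smooth solutions
exist globally: T = ∞.» — with p. 1 l. 26–41: (1) `∂ₜu + (u·∇)u = νΔu − ∇p`, (2) `∇·u = 0`, (3) `u(x,0) =
u₀(x)` on `ℝ³ × [0,T)`, «with ν > 0 constant. This is exactly Clay Problem A: u₀ ∈ C_c^∞(ℝ³), ∇·u₀ = 0, E₀ =
½‖u₀‖²_{L²} < ∞»; abstract p. 1 l. 15–24: «We prove a universal pointwise bound for smooth solutions of the 3D
incompressible Navier-Stokes equations with finite energy initial data: R(t)²X(t) ≤ C. … This inequality,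
combined with the energy identity, excludes finite-time blow-up and establishes global regularity. The proof
uses only the energy identity and Gagliardo-Nirenberg interpolation.»

RENDERING (precedents C17 `Chae2007`, C119 `Permana2026`, C148 `Fulber2026`, C102 `Santak2026` — vocabulary REUSED
BY NAME): «smooth solution to (1)-(3) on [0,T)» with finite energy = the Beale–Kato–Majda class
`Chae2007.IsLocalSolution ν T v₀ u p` (classical on `ℝ³ × [0,T)`, all `L²` Sobolev norms bounded on compact
sub-slabs) from a datum `Chae2007.IsDatum v₀` (smooth, divergence free, every derivative in `L²` — in particular
finite energy and finite `X`); «exist globally» = `Chae2007.IsGlobalSolution`. `ClaimedTheorem` is the printed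
face with the printed data class `C_c^∞` (p. 1); `ClaimedTheoremH` is the abstract's face «finite energy
initial data» over `IsDatum` — LITERALLY the C119 headline (`claimedH_iff_permana`), and the one the printed
proof (which never uses compact support) would establish: `claimedH_of_steps`, `clay_of_steps` PROVED.

## Clay delta (reference `Literature.Claims.NS.ClayVariants`, axes Δ1–Δ8)

Nearest: (A) `clayR3` (named on p. 1). Δ1 ℝ³ =; Δ2 NS (1)–(2), `ν > 0` =; Δ3 `f ≡ 0` =; **Δ4 data «u₀ ∈ C_c^∞(ℝ³)»
is NARROWER than Fefferman's class (4)** (Schwartz-type decay): `ClaimedTheorem → clayR3.Regularity` is NOT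
provable from the printed sentence alone — recorded as `ClayDelta` (the printed identification «Clay Problem A:
u₀ ∈ C_c^∞» read as «every admissible datum is compactly supported», false) with `clay_of_claimed_of_delta`;
the abstract's face `ClaimedTheoremH` DOES imply (A) (`clay_of_claimedH`, the C119 door), and the typed chain
yields it (`clay_of_steps`); Δ5/Δ6 «smooth solutions exist globally: T = ∞» — no energy clause (7) printed
(classical in the BKM class); Δ7 all `t ≥ 0` =. Not a «wrong problem» candidate by itself (POS claim on ℝ³).

## Vocabulary (p. 1 Defs 1.1–1.2; p. 2 Step 2)

For a velocity slice `w : ℝ³ → ℝ³`: `energyF w = ½∫|w|²` (Def 1.1, real; `E₀ = energyF (u 0)`), `XF w = ∫|∇w|²`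
(Def 1.1 «Enstrophy» = the full-gradient Frobenius square, real: `toReal` of the `[0,∞]`-valued `XeF`; junk `0`
off `H¹` — every field quantified below is `H¹`), local energies / local gradient squares over balls as
`[0,∞]`-valued / real set integrals. **Definition 1.2 p. 1 l. 50–62 «R(t) = sup{ r > 0 : ∃x₀ ∈ ℝ³ s.t.
∫_{B(x₀,r)}|u(y,t)|²dy ≥ E₀/2 }. If no such r exists, set R(t) = +∞»** is typed TWICE (REF v0.0 flag (a)): AS
PRINTED (`Rsup`, a supremum over an upward-closed set of radii — `= +∞` whenever the set is non-empty, kernel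
fact `rsup_eq_top`, so the literal Theorem 2.1 `Thm21_sup` asserts `X(t) = 0` by Remark 1.1's arithmetic) and in
the CHARITABLE reading the proofs use (`Rinf`, the INFIMUM radius of a ball holding half of `E₀`: Step 2 p. 2
l. 16 «Let x₀, R = R(t) achieve … so ∫_{B_R}|u|² ≥ E₀/2»); (5)/(6)/(7)/(8)/Thm 2.1 are stated on `Rinf`, with the
centre `x₀` of Step 2 explicit (`IsCentre`). Values `R ∈ (0, +∞]` live in `ℝ≥0∞` (`⊤ * 0 = 0`, `⊤ * x = ⊤` for
`x ≠ 0`: exactly Remark 1.1's «R = ∞ forces X = 0»). The single printed constant `C_GN` («the universal constant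
from the 3D Gagliardo–Nirenberg inequality», Thm 2.1; Remark 4.2 «Numerical value of C_GN is irrelevant.
Existence of any finite constant suffices») threads Step 3, (6), (8), Thm 2.1 and Point 3: it is carried as a
parameter `C : ℝ` of those Props (one `C` for all fields/solutions), with the existential faces `…_ex`.

## Step list (printed chain, LOCATORS §1: (4) → Step 2 → Step 3 → Step 4 ⇒ (6) → Lemma 2.1 (7) [(8)] →
## Thm 2.1 → Thm 3.1 Points 1–3); order of `claimH_of_steps` = this order

* `Step0_dichotomy` — p. 3 l. 13–15 «Assume maximal time T* < ∞ exists with blow-up: lim_{t→T*⁻} X(t) = ∞»: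
  the implicit local theory + `H¹` continuation alternative (REF flag (f)); classical, TRUE-type (tree: the
  `H³` version `Chae2007.step_1_holds`; the `X → ∞` clause is Leray's). Typist's flag: plausible.
* `Step1_energy` — Step 1 (4) p. 2 l. 7–14 (+ Point 2 p. 3 l. 21–24): energy identity and `E(t) ≥ 0`. TRUE-type.
* `Step2_localisation` — Step 2 (5) p. 2 l. 15–25: a centre `x₀` with `R = R⁻(t) < ∞` achieving `∫_{B_R}|u|² ≥
  E₀/2`. Typist's flag: TRUE while `E(t) > E₀/4` (so at `t = 0`); FALSE on slices whose energy has decayed below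
  `E₀/4` (`R⁻ = +∞`), where Thm 2.1 then asserts `X(t) = 0`. The cut-off `ϕ` (l. 24–25) is `IsCutoff`.
* `Step3_GN_asPrinted C` — Step 3 p. 2 l. 26–29 «Apply GN to v = uϕ in 3D: ‖v‖²_{L⁴} ≤ C_GN‖v‖_{L²}‖∇v‖_{L²}»
  AT THE FUNCTIONS GRAIN (every `v ∈ C_c^∞(ℝ³;ℝ³)`), exponents (1,1) AS PRINTED (REF flag (b): the 2-D
  Ladyzhenskaya exponents; typist's flag: suspicious — under `v(x) ↦ v(x/ℓ)` the two sides scale as `ℓ^{3/2}`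
  and `ℓ²`); `Step3_GN_3D C` — the charity-corrected 3-D face (exponents ¼, ¾; TRUE-type, REF flag (b′));
  `Step3_expand` — «Expand: ‖∇v‖_{L²} ≤ ‖∇u‖_{L²(B_{2R})} + (2/R)‖u‖_{L²(B_{2R})}» (TRUE-type, routine).
* `Step4_Holder` — Step 4 p. 2 l. 33–42 «By Hölder on B_R: ‖v‖⁴_{L⁴} ≥ |B_R|⁻¹‖v‖⁴_{L²}» (TRUE-type; the
  constant `C R⁻³E₀²` is `|B₁|⁻¹/4 · R⁻³E₀²` once `‖v‖²_{L²(B_R)} ≥ E₀/2`).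
* `Step6_display C` — **display (6) p. 2 l. 43–49 «Combining Steps 3-4 gives the local estimate: R²∫_{B_{2R}}
  |∇u|² ≤ 8C_GN E₀»**, typed AS DISPLAYED along solutions (every centre of Step 2); `Step6_glue C` — the printed
  INFERENCE «Steps 3–4 ⇒ (6)» at the field grain, taking the 3-D GN face (REF flags (c), (b′)). Typist's flag:
  suspicious (Step 3 bounds `‖v‖_{L⁴}` from ABOVE, Step 4 from BELOW; their combination bounds `‖v‖₂‖∇v‖₂` from
  BELOW, not `∫|∇u|²` from above; (6) is false for data carrying small-amplitude high-frequency oscillations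
  inside the energy ball).
* `Step5a_exterior C` — (8) p. 2 l. 75–91 (exterior twin of (6)); `Step5b_inference C` — p. 2 l. 92–113 «Add (6)
  and (8) … The only case consistent with X(t) → ∞ is (7)» (the printed derivation of (7); typist's flag:
  suspicious — `X(t)` is a fixed number at fixed `t`); `Step5_L21` — **Lemma 2.1 (7) p. 2 l. 51–59 «Enstrophy
  follows Energy … ∫_{B_{2R(t)}}|∇u(x,t)|²dx ≥ ½X(t)»** (typist's flag: suspicious — two-bump data).
* `Thm21 C` — Theorem 2.1 p. 2 l. 2–6 (charitable `R⁻`), DERIVED twice as printed: `thm21_of_steps` (p. 3 l. 1–9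
  «Apply Lemma 2.1 to (6)») and recorded route «Add (6) and (8)»; `Thm21_sup C` the literal face; `…_field`
  faces = the `t = 0` instances on data (`thm21_field_of_thm21` etc., via the tree's local existence).
* `Step_P1 C` — Point 1 p. 3 l. 16–20 (TRUE-type); `Step_P3rev C` — **Point 3 p. 3 l. 25–28 «Using Theorem 2.1,
  X(s) ≥ 16C_GN E₀/R(s)²»** AS PRINTED (the REVERSE of Thm 2.1's direction; REF flag (e)); `Step_P3tail C` —
  the rest of Point 3, p. 3 l. 28–49, at the real-function grain («R ≥ c√(T*−s)» ⇒ «X ≤ C/(T*−s)» ⇒ «∫X = ∞»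
  ⇒ «E(T*) < 0»), typist's flag: suspicious (`X(s) = (T*−s)^{−1/2}`-type profiles satisfy every hypothesis);
  `Step_Thm31_inference C` — the abstract's face «scale law + energy identity ⇒ no blow-up» (without the
  reverse inequality), implies `Step_P3tail C`.
* COMPOSITION: `claimH_of_steps` / `claim_of_steps` PROVED (pure logic + `toReal` bookkeeping): the chain
  composes AS PRINTED — no BREAKS-AT-LOGIC; `clay_of_steps` PROVED.

WHAT THIS IS NOT: not a claim about NS regularity or blow-up; not a claim about any author beyond the typed
locator.
-/

noncomputable section

open Set Function Filter MeasureTheory Metric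
open scoped Topology ENNReal NNReal ContDiff

namespace Literature.Claims.NS.Alneel2026

open Literature.Analysis.FluidPDE
open Literature.Claims.NS.Chae2007 (IsDatum IsLocalSolution IsGlobalSolution BlowsUpAt)

/-- Shorthand for `ℝ³` (an `abbrev`, as in the sibling skeletons; no notation). [folklore] -/
abbrev E3 : Type := EuclideanSpace ℝ (Fin 3)

/-! ### Vocabulary (Definitions 1.1–1.2, p. 1; Step 2, p. 2) -/

/-- Def 1.1 p. 1 l. 42–45: «Energy: E(t) = ½∫_{ℝ³}|u(x,t)|²dx», as a real number of the slice `w = u(·,t)`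
(`toReal`; finite for every field quantified in this file). [cite: Alneel2026, Def 1.1 p.1 l.42–45] -/
def energyF (w : E3 → E3) : ℝ :=
  (1 / 2) * (∫⁻ x, ‖w x‖ₑ ^ 2).toReal

/-- Def 1.1 p. 1 l. 46–49: «Enstrophy: X(t) = ∫_{ℝ³}|∇u(x,t)|²dx» (the FULL gradient, Frobenius square
`|∇w|² = Σᵢⱼ(∂ᵢwⱼ)²` = tree `frobeniusNormSq`), in `[0,∞]`. [cite: Alneel2026, Def 1.1 p.1 l.46–49] -/
def XeF (w : E3 → E3) : ℝ≥0∞ :=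
  ∫⁻ x, ENNReal.ofReal (frobeniusNormSq (fderiv ℝ w x))

/-- `X` of Def 1.1 as the printed REAL number (`toReal` of `XeF`; junk `0` off `H¹`, never met below).
[cite: Alneel2026, Def 1.1 p.1 l.46–49] -/
def XF (w : E3 → E3) : ℝ :=
  (XeF w).toReal

/-- `∫_{B(x₀,r)}|w(y)|²dy` (Def 1.2 p. 1 l. 50–62; (5) p. 2), in `[0,∞]`. [cite: Alneel2026, Def 1.2 p.1 l.50–62] -/
def locEnergy (w : E3 → E3) (x₀ : E3) (r : ℝ) : ℝ≥0∞ :=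
  ∫⁻ y in ball x₀ r, ‖w y‖ₑ ^ 2

/-- `∫_S |∇w|²` over a region `S` ((6): `B_{2R}`; (8): `B_{2R}ᶜ`), as a real number.
[cite: Alneel2026, (6) p.2 l.43–49; (8) p.2 l.85–91] -/
def locX (w : E3 → E3) (S : Set E3) : ℝ :=
  (∫⁻ y in S, ENNReal.ofReal (frobeniusNormSq (fderiv ℝ w y))).toReal

/-- The set of Definition 1.2 p. 1 l. 50–62: radii `r > 0` such that SOME ball of radius `r` holds at least
half of the INITIAL energy `E₀` («∫_{B(x₀,r)}|u(y,t)|²dy ≥ E₀/2»). Upward closed in `r` (`mem_capRadii_of_le`).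
[cite: Alneel2026, Def 1.2 p.1 l.50–62] -/
def capRadii (E₀ : ℝ) (w : E3 → E3) : Set ℝ :=
  {r | 0 < r ∧ ∃ x₀ : E3, ENNReal.ofReal (E₀ / 2) ≤ locEnergy w x₀ r}

open Classical in
/-- **Definition 1.2 AS PRINTED** (p. 1 l. 50–62): «R(t) = sup{ r > 0 : ∃x₀ … ≥ E₀/2 }. If no such r exists, set
R(t) = +∞.» — the SUPREMUM of `capRadii`, `+∞` on the empty set. Kernel fact: `= +∞` as soon as the set is
non-empty (`rsup_eq_top`), so as printed `R(t) = +∞` always. [cite: Alneel2026, Def 1.2 p.1 l.50–62] -/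
def Rsup (E₀ : ℝ) (w : E3 → E3) : ℝ≥0∞ :=
  if (capRadii E₀ w).Nonempty then sSup (ENNReal.ofReal '' capRadii E₀ w) else ⊤

/-- **Definition 1.2, CHARITABLE reading** (the «energy concentration scale» Step 2 p. 2 l. 16 uses: the
smallest radius of a ball holding `E₀/2`): the INFIMUM of `capRadii`, `+∞` on the empty set (`sInf ∅ = ⊤`).
[cite: Alneel2026, Def 1.2 p.1 l.50–62; Step 2 p.2 l.15–23] -/
def Rinf (E₀ : ℝ) (w : E3 → E3) : ℝ≥0∞ :=
  sInf (ENNReal.ofReal '' capRadii E₀ w)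

/-- Step 2 p. 2 l. 16–23 «Let x₀, R = R(t) achieve the supremum in Definition 1.2, so ∫_{B_R}|u|² ≥ E₀/2 (5)»:
`x₀` is a CENTRE for the slice `w` — `R⁻ < ∞` and the ball `B(x₀, R⁻)` holds at least `E₀/2`.
[cite: Alneel2026, Step 2 (5) p.2 l.15–23] -/
def IsCentre (E₀ : ℝ) (w : E3 → E3) (x₀ : E3) : Prop :=
  Rinf E₀ w < ⊤ ∧ ENNReal.ofReal (E₀ / 2) ≤ locEnergy w x₀ (Rinf E₀ w).toReal

/-- Step 2 p. 2 l. 24–25 «Take cut-off ϕ ∈ C_c^∞ with ϕ = 1 on B_R, ϕ = 0 outside B_{2R}, |∇ϕ| ≤ 2/R» (and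
`0 ≤ ϕ ≤ 1`, implicit). [cite: Alneel2026, Step 2 p.2 l.24–25] -/
def IsCutoff (x₀ : E3) (R : ℝ) (φ : E3 → ℝ) : Prop :=
  ContDiff ℝ ∞ φ ∧ (∀ y ∈ ball x₀ R, φ y = 1) ∧ (∀ y, y ∉ ball x₀ (2 * R) → φ y = 0) ∧
    (∀ y, 0 ≤ φ y ∧ φ y ≤ 1) ∧ ∀ y, ‖fderiv ℝ φ y‖ ≤ 2 / R

/-- A property `P E₀ w` of (initial energy, slice) holds ALONG SOLUTIONS: for every `ν > 0`, every `T > 0`,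
every class solution `(u,p)` on `ℝ³ × [0,T)` from a datum `v₀`, and every `t ∈ [0,T)`, with `E₀ = E(0)` —
the quantifier prefix «Let u be a smooth solution to (1)-(3) on [0,T). Then for all t ∈ [0,T)» of Thm 2.1
p. 2 l. 2–3. [cite: Alneel2026, Thm 2.1 p.2 l.2–3] -/
def AlongSolutions (P : ℝ → (E3 → E3) → Prop) : Prop :=
  ∀ ν : ℝ, 0 < ν → ∀ T : ℝ, 0 < T → ∀ (v₀ : E3 → E3) (u : ℝ → E3 → E3) (p : ℝ → E3 → ℝ),
    IsLocalSolution ν T v₀ u p → ∀ t ∈ Ico 0 T, P (energyF (u 0)) (u t)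

/-- The same property ON DATA (the `t = 0` instance: one smooth divergence-free finite-energy field, `E₀` = its
own energy) — REF flag (d) «decidable at t = 0 on a datum»; implied by the solution-grain statement through the
tree's local existence (`onData_of_alongSolutions`). [cite: Alneel2026, Thm 2.1 p.2 l.2–3] -/
def OnData (P : ℝ → (E3 → E3) → Prop) : Prop :=
  ∀ w : E3 → E3, IsDatum w → P (energyF w) w

/-! ### The claimed statement (Theorem 3.1 p. 3 with the data of p. 1) -/

/-- **HEADLINE — Theorem 3.1 (No Finite-Time Blow-up) p. 3 l. 11–12, AS PRINTED with the printed data class of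
p. 1 l. 31–41 («Clay Problem A: u₀ ∈ C_c^∞(ℝ³), ∇·u₀ = 0, E₀ < ∞»)**: for every `ν > 0` and every smooth,
divergence-free, COMPACTLY SUPPORTED datum «smooth solutions exist globally: T = ∞» — rendered as the existence of
a global BKM-class solution. [claim: Alneel2026, status: disputed] -/
def ClaimedTheorem : Prop :=
  ∀ ν : ℝ, 0 < ν → ∀ v₀ : E3 → E3, ContDiff ℝ ∞ v₀ → VectorCalculus.IsDivFree v₀ → HasCompactSupport v₀ →
    ∃ (u : ℝ → E3 → E3) (p : ℝ → E3 → ℝ), IsGlobalSolution ν v₀ u p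

/-- **The abstract's face** (p. 1 l. 15–17 «smooth solutions … with finite energy initial data»; Thm 2.1 «Let u
be a smooth solution»): the same conclusion for EVERY datum of the class (`IsDatum`: smooth, divergence free, all
derivatives in `L²` ⊇ Fefferman's (4) ⊇ `C_c^∞`). Token for token the C119 headline (`claimedH_iff_permana`).
[claim: Alneel2026, status: disputed] [cite: Alneel2026, abstract p.1 l.15–24; Thm 3.1 p.3 l.11–12] -/
def ClaimedTheoremH : Prop :=
  ∀ ν : ℝ, 0 < ν → ∀ v₀ : E3 → E3, IsDatum v₀ →
    ∃ (u : ℝ → E3 → E3) (p : ℝ → E3 → ℝ), IsGlobalSolution ν v₀ u p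

/-- **Δ4 (data axis), the printed identification «This is exactly Clay Problem A: u₀ ∈ C_c^∞(ℝ³)» p. 1
l. 31–41 read as a statement**: every admissible datum (smooth, divergence free, finite energy with all
derivatives in `L²` — in particular every Clay datum of class (4)) is compactly supported. FALSE (Schwartz,
non-compactly-supported fields), recorded as the residual delta under which the printed sentence would give (A)
(`clay_of_claimed_of_delta`); not a locator candidate by itself. [cite: Alneel2026, §1 p.1 l.31–41]
[cite: FeffermanClay2006, (4) p.1] -/
def ClayDelta : Prop :=
  ∀ v₀ : E3 → E3, IsDatum v₀ → HasCompactSupport v₀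

/-! ### Step 0 — the blow-up alternative assumed on p. 3 l. 13–15 -/

/-- **Step 0 (implicit; p. 3 l. 13–15 «Proof by Contradiction. Assume maximal time T* < ∞ exists with blow-up:
lim_{t→T*⁻} X(t) = ∞»)**: for every `ν > 0` and every datum, EITHER a global class solution exists OR there is a
class solution on some `[0,T*)`, `0 < T* < ∞`, along which `X(t) = ‖∇u(t)‖²_{L²} → +∞` as `t → T*⁻`
(local existence + the `H¹`/enstrophy continuation criterion, Leray 1934). Classical, TRUE-type (tree: the
`H³`-sum version is `Chae2007.step_1_holds`; the `X → ∞` clause needs the `H¹` blow-up rate, not ported here).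
Typist's flag: plausible. [cite: Alneel2026, Thm 3.1 proof p.3 l.13–15] [cite: Leray1934, (3.17)] -/
def Step0_dichotomy : Prop :=
  ∀ ν : ℝ, 0 < ν → ∀ v₀ : E3 → E3, IsDatum v₀ →
    (∃ (u : ℝ → E3 → E3) (p : ℝ → E3 → ℝ), IsGlobalSolution ν v₀ u p) ∨
    ∃ Ts : ℝ, 0 < Ts ∧ ∃ (u : ℝ → E3 → E3) (p : ℝ → E3 → ℝ),
      IsLocalSolution ν Ts v₀ u p ∧ Tendsto (fun t => XF (u t)) (𝓝[<] Ts) atTop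

/-! ### Step 1 — energy identity (4), p. 2 l. 7–14 -/

/-- **Step 1 — (4) p. 2 l. 7–14 «Multiplying (1) by u and integrating: d/dt E(t) + νX(t) = 0 ⇒ E(t) +
ν∫₀ᵗX(s)ds = E₀. Thus 0 ≤ E(t) ≤ E₀ for all t»** (= Point 2 p. 3 l. 21–24), along class solutions, with the
continuity of `t ↦ X(t)` on `[0,T)` that the printed `∫₀ᵗX(s)ds` presupposes. Classical, TRUE-type (tree:
`IsClassicalNSSolutionOn.bkm_energy_le`, `energyEq_of_finiteEnergy`). Typist's flag: plausible.
[cite: Alneel2026, Step 1 (4) p.2 l.7–14; Point 2 p.3 l.21–24] [cite: Leray1934, (2.18)] -/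
def Step1_energy : Prop :=
  ∀ ν : ℝ, 0 < ν → ∀ T : ℝ, 0 < T → ∀ (v₀ : E3 → E3) (u : ℝ → E3 → E3) (p : ℝ → E3 → ℝ),
    IsLocalSolution ν T v₀ u p →
      ContinuousOn (fun t => XF (u t)) (Ico 0 T) ∧
      ∀ t ∈ Ico 0 T, energyF (u t) + ν * ∫ s in (0:ℝ)..t, XF (u s) = energyF (u 0) ∧ 0 ≤ energyF (u t)

/-! ### Step 2 — localisation (5), p. 2 l. 15–25 -/

/-- **Step 2 — p. 2 l. 15–23 «Fix t. Let x₀, R = R(t) achieve the supremum in Definition 1.2, so ∫_{B_R}|u|² ≥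
E₀/2 (5)»** (charitable `R⁻`): along class solutions, at every time there is a centre — `R⁻(t) < ∞` and a ball
`B(x₀, R⁻(t))` holding `E₀/2`. Typist's flag: TRUE while `E(t) > E₀/4` (in particular at `t = 0`); suspicious
in general (on a slice with `E(t) < E₀/4` no ball holds `E₀/2`, `R⁻ = +∞`, and Theorem 2.1 then reads
`X(t) = 0`, Remark 1.1). [claim: Alneel2026, status: disputed] [cite: Alneel2026, Step 2 (5) p.2 l.15–23] -/
def Step2_localisation : Prop :=
  AlongSolutions fun E₀ w => ∃ x₀ : E3, IsCentre E₀ w x₀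

/-! ### Step 3 — Gagliardo–Nirenberg, p. 2 l. 26–32 -/

/-- **Step 3 AS PRINTED — p. 2 l. 26–29 «Apply GN to v = uϕ in 3D: ‖v‖²_{L⁴} ≤ C_GN‖v‖_{L²}‖∇v‖_{L²} [2]»**, at
the functions grain with the printed exponents (1,1): for every smooth compactly supported `v : ℝ³ → ℝ³`,
`(∫|v|⁴)^{1/2} ≤ C·(∫|v|²)^{1/2}·(∫|∇v|²)^{1/2}`. Typist's flag: suspicious (these are the 2-D Ladyzhenskaya
exponents; in ℝ³ the two sides scale as `ℓ^{3/2}` vs `ℓ²` under `v(x) ↦ v(x/ℓ)`). [claim: Alneel2026, status: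
disputed] [cite: Alneel2026, Step 3 p.2 l.26–29] -/
def Step3_GN_asPrinted (C : ℝ) : Prop :=
  ∀ v : E3 → E3, ContDiff ℝ ∞ v → HasCompactSupport v →
    Real.sqrt (∫ x, ‖v x‖ ^ 4) ≤
      C * Real.sqrt (∫ x, ‖v x‖ ^ 2) * Real.sqrt (∫ x, frobeniusNormSq (fderiv ℝ v x))

/-- **Step 3, charity-corrected 3-D face** (REF v0.0a flag (b′); Ladyzhenskaya/Gagliardo–Nirenberg in ℝ³:
`‖v‖²_{L⁴} ≤ C‖v‖^{1/2}_{L²}‖∇v‖^{3/2}_{L²}`): TRUE-type for a suitable `C` (classical). Not the printed display.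
[cite: Alneel2026, Step 3 p.2 l.26–29] [cite: BahouriCheminDanchin2011, §1.4.1] -/
def Step3_GN_3D (C : ℝ) : Prop :=
  ∀ v : E3 → E3, ContDiff ℝ ∞ v → HasCompactSupport v →
    Real.sqrt (∫ x, ‖v x‖ ^ 4) ≤
      C * (∫ x, ‖v x‖ ^ 2) ^ (1 / 4 : ℝ) * (∫ x, frobeniusNormSq (fderiv ℝ v x)) ^ (3 / 4 : ℝ)

/-- Existential packaging of the printed constant (Thm 2.1 «C_GN is the universal constant …»; Remark 4.2
«Existence of any finite constant suffices»): SOME `C` makes the printed Step 3 display true for all `v`.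
[claim: Alneel2026, status: disputed] [cite: Alneel2026, Step 3 p.2 l.26–29; Remark 4.2 p.3 l.54–55] -/
def Step3_GN_asPrinted_ex : Prop :=
  ∃ C : ℝ, Step3_GN_asPrinted C

/-- **Step 3, expansion clause — p. 2 l. 29–32 «Expand: ‖∇v‖_{L²} ≤ ‖∇u‖_{L²(B_{2R})} + (2/R)‖u‖_{L²(B_{2R})}»**
for `v = ϕu` with a cut-off of Step 2 (product rule + `|ϕ| ≤ 1`, `|∇ϕ| ≤ 2/R`, `supp ϕ ⊂ B_{2R}`). Routine,
TRUE-type. [cite: Alneel2026, Step 3 p.2 l.29–32] -/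
def Step3_expand : Prop :=
  ∀ (w : E3 → E3) (x₀ : E3) (R : ℝ) (φ : E3 → ℝ), IsDatum w → 0 < R → IsCutoff x₀ R φ →
    Real.sqrt (∫ x, frobeniusNormSq (fderiv ℝ (fun y => φ y • w y) x)) ≤
      Real.sqrt (locX w (ball x₀ (2 * R))) + (2 / R) * Real.sqrt ((locEnergy w x₀ (2 * R)).toReal)

/-! ### Step 4 — Hölder lower bound, p. 2 l. 33–42 -/

/-- **Step 4 — p. 2 l. 33–42 «From (5): ‖v‖²_{L²} ≥ E₀/2. By Hölder on B_R: ‖v‖⁴_{L⁴} ≥ |B_R|⁻¹‖v‖⁴_{L²} ≥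
CR⁻³E₀²»**, the Hölder display at the functions grain (in `[0,∞]`, no integrability side condition): for every
field `v`, centre `x₀` and `R > 0`, `(∫_{B_R}|v|²)² ≤ |B_R|·∫_{ℝ³}|v|⁴`. TRUE (Cauchy–Schwarz on the ball).
[cite: Alneel2026, Step 4 p.2 l.33–42] -/
def Step4_Holder : Prop :=
  ∀ (v : E3 → E3) (x₀ : E3) (R : ℝ), 0 < R →
    (∫⁻ y in ball x₀ R, ‖v y‖ₑ ^ 2) ^ 2 ≤ volume (ball x₀ R) * ∫⁻ y, ‖v y‖ₑ ^ 4

/-! ### Display (6), p. 2 l. 43–49 — «Combining Steps 3-4 gives the local estimate» -/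

/-- The content of display (6) for one slice `w`, initial energy `E₀`, centre `x₀` (with `R = R⁻`):
`R²∫_{B(x₀,2R)}|∇w|² ≤ 8·C·E₀`. [cite: Alneel2026, (6) p.2 l.43–49] -/
def Disp6 (C E₀ : ℝ) (w : E3 → E3) (x₀ : E3) : Prop :=
  Rinf E₀ w ^ 2 * ENNReal.ofReal (locX w (ball x₀ (2 * (Rinf E₀ w).toReal))) ≤ ENNReal.ofReal (8 * C * E₀)

/-- **Display (6) p. 2 l. 43–49 «Combining Steps 3-4 gives the local estimate: R²∫_{B_{2R}}|∇u|² ≤ 8C_GN E₀»,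
AS DISPLAYED**: along class solutions, at every time and for every centre of Step 2. Typist's flag: suspicious
(energy-level left side conditions vs an enstrophy-level conclusion: a datum with a small-amplitude
high-frequency divergence-free oscillation inside its energy ball keeps `E₀`, `R⁻`, `x₀` and makes the local
gradient square arbitrarily large). [claim: Alneel2026, status: disputed] [cite: Alneel2026, (6) p.2 l.43–49] -/
def Step6_display (C : ℝ) : Prop :=
  AlongSolutions fun E₀ w => ∀ x₀ : E3, IsCentre E₀ w x₀ → Disp6 C E₀ w x₀

/-- **The printed INFERENCE «Combining Steps 3-4 gives (6)» (p. 2 l. 43), at the field grain, taking the 3-D GN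
face** (REF flags (c), (b′)): for one finite-energy smooth divergence-free field `w` with `E(w) ≤ E₀`, a centre
`x₀` (`R = R⁻ < ∞`, `∫_{B_R}|w|² ≥ E₀/2`) and a cut-off `ϕ`, IF `v = ϕw` satisfies the 3-D Gagliardo–Nirenberg
display with constant `C` and the Hölder display of Step 4, THEN (6) holds. Typist's flag: suspicious (an upper
bound on `‖v‖_{L⁴}` and a lower bound on `‖v‖_{L⁴}` combine to a LOWER bound on `‖v‖_{L²}‖∇v‖_{L²}`; no upper
bound on `∫|∇u|²` follows). [claim: Alneel2026, status: disputed] [cite: Alneel2026, (6) p.2 l.43–49] -/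
def Step6_glue (C : ℝ) : Prop :=
  ∀ (E₀ : ℝ) (w : E3 → E3) (x₀ : E3) (φ : E3 → ℝ), IsDatum w → energyF w ≤ E₀ → IsCentre E₀ w x₀ →
    IsCutoff x₀ (Rinf E₀ w).toReal φ →
    -- Step 3 (3-D face) for `v = ϕw`
    Real.sqrt (∫ x, ‖φ x • w x‖ ^ 4) ≤
      C * (∫ x, ‖φ x • w x‖ ^ 2) ^ (1 / 4 : ℝ) *
        (∫ x, frobeniusNormSq (fderiv ℝ (fun y => φ y • w y) x)) ^ (3 / 4 : ℝ) →
    -- Step 4 for `v = ϕw` on `B_R` («‖v‖⁴_{L⁴} ≥ |B_R|⁻¹‖v‖⁴_{L²}», `‖v‖²_{L²(B_R)} ≥ E₀/2`)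
    (∫⁻ y in ball x₀ (Rinf E₀ w).toReal, ‖φ y • w y‖ₑ ^ 2) ^ 2 ≤
      volume (ball x₀ (Rinf E₀ w).toReal) * ∫⁻ y, ‖φ y • w y‖ₑ ^ 4 →
    Disp6 C E₀ w x₀

/-! ### Step 5 — «No-Escape Lemma», Lemma 2.1 (7), p. 2 l. 50–113 -/

/-- The content of display (8) p. 2 l. 85–91 («R²∫_{B_{2R}ᶜ}|∇u|² ≤ 8C_GN E₀») for one slice and centre.
[cite: Alneel2026, (8) p.2 l.75–91] -/
def Disp8 (C E₀ : ℝ) (w : E3 → E3) (x₀ : E3) : Prop :=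
  Rinf E₀ w ^ 2 * ENNReal.ofReal (locX w (ball x₀ (2 * (Rinf E₀ w).toReal))ᶜ) ≤ ENNReal.ofReal (8 * C * E₀)

/-- The content of Lemma 2.1's display (7) p. 2 l. 51–59 («∫_{B_{2R(t)}}|∇u(x,t)|²dx ≥ ½X(t)») for one slice
and centre. [cite: Alneel2026, Lemma 2.1 (7) p.2 l.51–59] -/
def Disp7 (E₀ : ℝ) (w : E3 → E3) (x₀ : E3) : Prop :=
  XF w ≤ 2 * locX w (ball x₀ (2 * (Rinf E₀ w).toReal))

/-- **(8) p. 2 l. 75–91 «Apply Gagliardo-Nirenberg on the exterior region B_{2R}ᶜ with cut-off ψ = 1 − ϕ …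
Since ∫_{B_Rᶜ}|u|² ≤ E₀/2, the same computation as Steps 3-4 gives: R²∫_{B_{2R}ᶜ}|∇u|² ≤ 8C_GN E₀ (8)»**, AS
DISPLAYED along class solutions for every centre. Typist's flag: suspicious (as (6): a far-away small
high-frequency bump raises the exterior gradient square at fixed `E₀`, `R⁻`).
[claim: Alneel2026, status: disputed] [cite: Alneel2026, (8) p.2 l.75–91] -/
def Step5a_exterior (C : ℝ) : Prop :=
  AlongSolutions fun E₀ w => ∀ x₀ : E3, IsCentre E₀ w x₀ → Disp8 C E₀ w x₀

/-- **The printed derivation of (7), p. 2 l. 92–113 «Add (6) and (8): R²X(t) = R²(∫_{B_{2R}} + ∫_{B_{2R}ᶜ})|∇u|²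
≤ 16C_GN E₀. If ∫_{B_{2R}}|∇u|² < ½X(t), then R²X(t) < 16C_GN E₀, but this would force R²X(t) → 0 as X(t) → ∞,
contradicting R > 0 from Definition 1.2. The only case consistent with X(t) → ∞ is (7)»**, typed as the
implication it asserts at each time and centre: (6) ∧ (8) ⇒ (7). Typist's flag: suspicious (at fixed `t` the
number `X(t)` does not «→ ∞»; (6)+(8) bound `R²X` from above and say nothing about where the gradient square
sits). [claim: Alneel2026, status: disputed] [cite: Alneel2026, Lemma 2.1 proof p.2 l.92–113] -/
def Step5b_inference (C : ℝ) : Prop :=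
  AlongSolutions fun E₀ w => ∀ x₀ : E3, IsCentre E₀ w x₀ → Disp6 C E₀ w x₀ → Disp8 C E₀ w x₀ → Disp7 E₀ w x₀

/-- **Step 5 — Lemma 2.1 («Enstrophy follows Energy», «IRONCLAD») display (7) p. 2 l. 51–59: «For all t,
∫_{B_{2R(t)}}|∇u(x,t)|²dx ≥ ½X(t)»**, along class solutions, for every centre of Step 2 (charitable `R⁻`).
Typist's flag: suspicious (two-bump data: half the energy in a unit bump fixing `x₀`, `R⁻`, almost all of the
gradient square in a far-away small-amplitude high-frequency bump outside `B_{2R}`).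
[claim: Alneel2026, status: disputed] [cite: Alneel2026, Lemma 2.1 (7) p.2 l.51–59] -/
def Step5_L21 : Prop :=
  AlongSolutions fun E₀ w => ∀ x₀ : E3, IsCentre E₀ w x₀ → Disp7 E₀ w x₀

/-! ### Theorem 2.1 (Universal Scale Law), p. 2 l. 2–6 -/

/-- The scale-law inequality for one slice: `R⁻² · X ≤ 16·C·E₀` in `[0,∞]` (`R⁻ = +∞` forces `X = 0`, Remark 1.1
p. 1 l. 63–65). [cite: Alneel2026, Thm 2.1 p.2 l.2–6; Remark 1.1 p.1 l.63–65] -/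
def ScaleLaw (C E₀ : ℝ) (w : E3 → E3) : Prop :=
  Rinf E₀ w ^ 2 * ENNReal.ofReal (XF w) ≤ ENNReal.ofReal (16 * C * E₀)

/-- **Theorem 2.1 (Universal Scale Law «CLOSED») p. 2 l. 2–6: «Let u be a smooth solution to (1)-(3) on [0,T).
Then for all t ∈ [0,T), R(t)²X(t) ≤ 16C_GN E₀»** on the charitable `R⁻`; DERIVED from Steps 2, (6), (7) as
printed (`thm21_of_steps`). Typist's flag: suspicious (false at `t = 0` for data with fixed energy profile and
large gradient square). [claim: Alneel2026, status: disputed] [cite: Alneel2026, Thm 2.1 p.2 l.2–6] -/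
def Thm21 (C : ℝ) : Prop :=
  AlongSolutions fun E₀ w => ScaleLaw C E₀ w

/-- Theorem 2.1 with the abstract's existential constant («R(t)²X(t) ≤ C», p. 1; Remark 4.2).
[claim: Alneel2026, status: disputed] [cite: Alneel2026, abstract p.1 l.15–18; Remark 4.2 p.3 l.54–55] -/
def Thm21_ex : Prop :=
  ∃ C : ℝ, Thm21 C

/-- **Theorem 2.1, LITERAL face** (Definition 1.2's `R` = the SUPREMUM `Rsup`): along class solutions
`Rsup² · X ≤ 16·C·E₀`. Since `Rsup = +∞` whenever some ball holds `E₀/2` (`rsup_eq_top`), this face asserts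
`X(t) = 0` on every such slice (Remark 1.1's arithmetic) — recorded for the degenerate-definition record (REF
flag (a), ROUTE 5b: a kill using only `R ≡ +∞` is a typing-grain record, not the locator).
[claim: Alneel2026, status: disputed] [cite: Alneel2026, Thm 2.1 p.2 l.2–6; Def 1.2 p.1 l.50–62] -/
def Thm21_sup (C : ℝ) : Prop :=
  AlongSolutions fun E₀ w => Rsup E₀ w ^ 2 * ENNReal.ofReal (XF w) ≤ ENNReal.ofReal (16 * C * E₀)

/-! ### Theorem 3.1, Points 1–3, p. 3 l. 13–49 -/

/-- **Point 1 p. 3 l. 16–20 «From Theorem 2.1, R(t)² ≤ 16C_GN E₀/X(t). Thus if X(t) → ∞ then R(t) → 0»**, at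
the real-function grain: for functions `X ≥ 0`, `R` on `[0,T*)` obeying the scale law, `X → +∞` at `T*⁻`
forces `R → 0`. TRUE-type (elementary). [cite: Alneel2026, Point 1 p.3 l.16–20] -/
def Step_P1 (C : ℝ) : Prop :=
  ∀ (E₀ Ts : ℝ) (X : ℝ → ℝ) (R : ℝ → ℝ≥0∞), 0 < Ts →
    (∀ t ∈ Ico 0 Ts, R t ^ 2 * ENNReal.ofReal (X t) ≤ ENNReal.ofReal (16 * C * E₀)) →
    Tendsto X (𝓝[<] Ts) atTop → Tendsto R (𝓝[<] Ts) (𝓝 0)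

/-- **Point 3, first sentence, p. 3 l. 25–28 «Using Theorem 2.1, X(s) ≥ 16C_GN E₀/R(s)²», AS PRINTED** (REF
flag (e)): along class solutions `16·C·E₀ ≤ R⁻(s)²X(s)` — the REVERSE of Theorem 2.1's inequality, attributed
to Theorem 2.1. Typist's flag: suspicious (not what Theorem 2.1 says; as a free-standing claim it fails for
slices with `R⁻ = +∞, X = 0` only if `C·E₀ > 0` …; decided by the refuter).
[claim: Alneel2026, status: disputed] [cite: Alneel2026, Point 3 p.3 l.25–28] -/
def Step_P3rev (C : ℝ) : Prop :=
  AlongSolutions fun E₀ w => ENNReal.ofReal (16 * C * E₀) ≤ Rinf E₀ w ^ 2 * ENNReal.ofReal (XF w)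

/-- **Point 3, the tail, p. 3 l. 28–49, at the real-function grain (TYPING-HYGIENE 13)**: «Substitute into (4):
E(t) ≤ E₀ − 16νC_GN E₀∫₀ᵗds/R(s)². If R(s) → 0 as s → T*, then for the integral to remain finite we must have
R(s) ≥ c√(T*−s). This implies X(s) ≤ C/(T*−s) and ∫₀^{T*}X(s)ds = ∞, forcing E(T*) < 0, contradicting Point 2.
Thus no finite T* exists.» Typed as the implication the proof needs: for `ν > 0`, `E₀ ≥ 0`, `0 < T*`, a
continuous `X ≥ 0` on `[0,T*)` and `R : [0,T*) → (0,+∞]` with (4)/Point 2 (`ν∫₀ᵗX ≤ E₀`), the scale law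
(Point 1's input), the reverse law (l. 25–28) and blow-up `X → +∞` at `T*⁻`, a contradiction. Typist's flag:
suspicious (`X(s) = ε(T*−s)^{−1/2}`, `R(s)² = 16CE₀/X(s)` satisfy every hypothesis: «R ≥ c√(T*−s)» does not follow
from the finiteness of `∫ds/R²`, and «∫X = ∞» does not follow from an UPPER bound `X ≤ C/(T*−s)`).
[claim: Alneel2026, status: disputed] [cite: Alneel2026, Point 3 p.3 l.28–49] -/
def Step_P3tail (C : ℝ) : Prop :=
  ∀ (ν E₀ Ts : ℝ) (X : ℝ → ℝ) (R : ℝ → ℝ≥0∞), 0 < ν → 0 ≤ E₀ → 0 < Ts →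
    ContinuousOn X (Ico 0 Ts) → (∀ t ∈ Ico 0 Ts, 0 ≤ X t) →
    (∀ t ∈ Ico 0 Ts, ν * ∫ s in (0:ℝ)..t, X s ≤ E₀) →
    (∀ t ∈ Ico 0 Ts, R t ^ 2 * ENNReal.ofReal (X t) ≤ ENNReal.ofReal (16 * C * E₀)) →
    (∀ t ∈ Ico 0 Ts, ENNReal.ofReal (16 * C * E₀) ≤ R t ^ 2 * ENNReal.ofReal (X t)) →
    Tendsto X (𝓝[<] Ts) atTop → False

/-- **The abstract's inference, p. 1 l. 18–20 «This inequality, combined with the energy identity, excludes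
finite-time blow-up» / Conclusion p. 3 l. 57–59**, at the real-function grain WITHOUT the reverse law of
Point 3: scale law + (4) + `E ≥ 0` + `X → ∞` ⇒ contradiction. Implies `Step_P3tail C` (`p3tail_of_inference`).
Typist's flag: suspicious (same profiles). [claim: Alneel2026, status: disputed]
[cite: Alneel2026, abstract p.1 l.18–20; §5 p.3 l.57–59] -/
def Step_Thm31_inference (C : ℝ) : Prop :=
  ∀ (ν E₀ Ts : ℝ) (X : ℝ → ℝ) (R : ℝ → ℝ≥0∞), 0 < ν → 0 ≤ E₀ → 0 < Ts →
    ContinuousOn X (Ico 0 Ts) → (∀ t ∈ Ico 0 Ts, 0 ≤ X t) →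
    (∀ t ∈ Ico 0 Ts, ν * ∫ s in (0:ℝ)..t, X s ≤ E₀) →
    (∀ t ∈ Ico 0 Ts, R t ^ 2 * ENNReal.ofReal (X t) ≤ ENNReal.ofReal (16 * C * E₀)) →
    Tendsto X (𝓝[<] Ts) atTop → False

/-! ### Kernel facts about the typed definitions (no step asserted) -/

/-- `capRadii` is upward closed: a larger ball with the same centre holds at least as much energy.
[cite: Alneel2026, Def 1.2 p.1 l.50–62] -/
theorem mem_capRadii_of_le {E₀ : ℝ} {w : E3 → E3} {r r' : ℝ} (hr : r ∈ capRadii E₀ w) (h : r ≤ r') :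
    r' ∈ capRadii E₀ w := by
  obtain ⟨hr0, x₀, hx₀⟩ := hr
  refine ⟨hr0.trans_le h, x₀, hx₀.trans ?_⟩
  exact lintegral_mono_set (ball_subset_ball h)

/-- **Definition 1.2 as printed is degenerate**: whenever SOME ball holds `E₀/2`, the printed `R` (a supremum
over the upward-closed `capRadii`) equals `+∞`. [cite: Alneel2026, Def 1.2 p.1 l.50–62] -/
theorem rsup_eq_top {E₀ : ℝ} {w : E3 → E3} (h : (capRadii E₀ w).Nonempty) : Rsup E₀ w = ⊤ := by
  rw [Rsup, if_pos h]
  obtain ⟨r₀, hr₀⟩ := h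
  refine ENNReal.eq_top_of_forall_nnreal_le fun c => ?_
  have hmem : max r₀ (c : ℝ) ∈ capRadii E₀ w := mem_capRadii_of_le hr₀ (le_max_left _ _)
  calc (c : ℝ≥0∞) = ENNReal.ofReal (c : ℝ) := (ENNReal.ofReal_coe_nnreal).symm
    _ ≤ ENNReal.ofReal (max r₀ (c : ℝ)) := ENNReal.ofReal_le_ofReal (le_max_right _ _)
    _ ≤ sSup (ENNReal.ofReal '' capRadii E₀ w) := le_sSup ⟨_, hmem, rfl⟩

/-- The printed and the charitable `R` agree on the empty set (`+∞`), and `R⁻ ≤ R` always.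
[cite: Alneel2026, Def 1.2 p.1 l.50–62] -/
theorem rinf_le_rsup (E₀ : ℝ) (w : E3 → E3) : Rinf E₀ w ≤ Rsup E₀ w := by
  by_cases h : (capRadii E₀ w).Nonempty
  · rw [rsup_eq_top h]; exact le_top
  · rw [Rsup, if_neg h]; exact le_top

/-- A global class solution restricts to a class solution on `[0,1)` (plumbing). [folklore] -/
private theorem isLocalSolution_of_isGlobalSolution {ν : ℝ} {v₀ : E3 → E3} {u : ℝ → E3 → E3} {p : ℝ → E3 → ℝ}
    (h : IsGlobalSolution ν v₀ u p) : IsLocalSolution ν 1 v₀ u p where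
  isClassical := h.isClassical.mono Ico_subset_Ici_self (uniqueDiffOn_Ico 0 1)
  initial := h.initial
  sobolev T'' _ := h.sobolev T''

/-- **Solution grain ⇒ field grain** (REF flag (d)): a statement «along every class solution at every time»
holds in particular for every DATUM at `t = 0` (`E₀` = its energy), because every datum launches a class
solution on some `[0,T)`, `T > 0` (the tree's BKM-class local existence inside `Chae2007.step_1_holds`, used
at `ν = 1`). [cite: Alneel2026, Thm 2.1 p.2 l.2–3] [cite: MajdaBertozzi2002, Thm. 3.6 and §3.3 (pp. 115–117)] -/
theorem onData_of_alongSolutions {P : ℝ → (E3 → E3) → Prop} (h : AlongSolutions P) : OnData P := by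
  intro w hw
  rcases Chae2007.step_1_holds 1 zero_le_one w hw with ⟨u, p, hg⟩ | ⟨T, hT, u, p, hl, -⟩
  · have hl : IsLocalSolution 1 1 w u p := isLocalSolution_of_isGlobalSolution hg
    have := h 1 one_pos 1 one_pos w u p hl 0 ⟨le_rfl, one_pos⟩
    rwa [hl.initial] at this
  · have := h 1 one_pos T hT w u p hl 0 ⟨le_rfl, hT⟩
    rwa [hl.initial] at this

/-! ### Field-grain («t = 0 on a datum») faces of the decisive displays -/

/-- (6) on data: for every datum `w` (with `E₀ = E(w)`) and every centre, `R⁻²∫_{B_{2R}}|∇w|² ≤ 8CE₀`.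
[claim: Alneel2026, status: disputed] [cite: Alneel2026, (6) p.2 l.43–49] -/
def Step6_field (C : ℝ) : Prop :=
  OnData fun E₀ w => ∀ x₀ : E3, IsCentre E₀ w x₀ → Disp6 C E₀ w x₀

/-- (7) on data. [claim: Alneel2026, status: disputed] [cite: Alneel2026, Lemma 2.1 (7) p.2 l.51–59] -/
def Step5_field : Prop :=
  OnData fun E₀ w => ∀ x₀ : E3, IsCentre E₀ w x₀ → Disp7 E₀ w x₀

/-- (8) on data. [claim: Alneel2026, status: disputed] [cite: Alneel2026, (8) p.2 l.75–91] -/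
def Step5a_field (C : ℝ) : Prop :=
  OnData fun E₀ w => ∀ x₀ : E3, IsCentre E₀ w x₀ → Disp8 C E₀ w x₀

/-- Theorem 2.1 on data: `R⁻(w)²·X(w) ≤ 16·C·E(w)` for every datum `w`. [claim: Alneel2026, status: disputed]
[cite: Alneel2026, Thm 2.1 p.2 l.2–6] -/
def Thm21_field (C : ℝ) : Prop :=
  OnData fun E₀ w => ScaleLaw C E₀ w

/-- Step 2 on data: every datum has a centre. [claim: Alneel2026, status: disputed]
[cite: Alneel2026, Step 2 (5) p.2 l.15–23] -/
def Step2_field : Prop :=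
  OnData fun E₀ w => ∃ x₀ : E3, IsCentre E₀ w x₀

/-- [cite: Alneel2026, (6) p.2 l.43–49] -/
theorem step6_field_of (C : ℝ) (h : Step6_display C) : Step6_field C := onData_of_alongSolutions h

/-- [cite: Alneel2026, Lemma 2.1 (7) p.2 l.51–59] -/
theorem step5_field_of (h : Step5_L21) : Step5_field := onData_of_alongSolutions h

/-- [cite: Alneel2026, (8) p.2 l.75–91] -/
theorem step5a_field_of (C : ℝ) (h : Step5a_exterior C) : Step5a_field C := onData_of_alongSolutions h

/-- [cite: Alneel2026, Thm 2.1 p.2 l.2–6] -/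
theorem thm21_field_of_thm21 (C : ℝ) (h : Thm21 C) : Thm21_field C := onData_of_alongSolutions h

/-- [cite: Alneel2026, Step 2 (5) p.2 l.15–23] -/
theorem step2_field_of (h : Step2_localisation) : Step2_field := onData_of_alongSolutions h

/-! ### Kernel relations between the typed steps -/

/-- **Theorem 2.1 from the printed chain, p. 3 l. 1–9 «Apply Lemma 2.1 to (6): R(t)²·½X(t) ≤ 8C_GN E₀. Hence
R(t)²X(t) ≤ 16C_GN E₀»**: Step 2 (a centre exists) + (6) + (7) give the scale law, at the typed grain (`[0,∞]`
arithmetic). [cite: Alneel2026, p.3 l.1–9] -/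
theorem scaleLaw_of_disp6_disp7 {C E₀ : ℝ} {w : E3 → E3} {x₀ : E3} (h6 : Disp6 C E₀ w x₀)
    (h7 : Disp7 E₀ w x₀) : ScaleLaw C E₀ w := by
  unfold ScaleLaw
  unfold Disp6 at h6
  unfold Disp7 at h7
  set L := locX w (ball x₀ (2 * (Rinf E₀ w).toReal)) with hL
  calc Rinf E₀ w ^ 2 * ENNReal.ofReal (XF w)
      ≤ Rinf E₀ w ^ 2 * ENNReal.ofReal (2 * L) := by
        gcongr
    _ = 2 * (Rinf E₀ w ^ 2 * ENNReal.ofReal L) := by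
        rw [ENNReal.ofReal_mul (by norm_num : (0:ℝ) ≤ 2), ENNReal.ofReal_ofNat]; ring
    _ ≤ 2 * ENNReal.ofReal (8 * C * E₀) := by
        gcongr
    _ = ENNReal.ofReal (16 * C * E₀) := by
        rw [show (16 : ℝ) * C * E₀ = 2 * (8 * C * E₀) by ring,
          ENNReal.ofReal_mul (by norm_num : (0:ℝ) ≤ 2), ENNReal.ofReal_ofNat]

/-- **Theorem 2.1 DERIVED as printed** (p. 3 l. 1–9): Step 2 → (6) → Lemma 2.1 (7) → Theorem 2.1, for the same
constant. [cite: Alneel2026, p.3 l.1–9; Thm 2.1 p.2 l.2–6] -/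
theorem thm21_of_steps (C : ℝ) (h2 : Step2_localisation) (h6 : Step6_display C) (h7 : Step5_L21) :
    Thm21 C := by
  intro ν hν T hT v₀ u p hsol t ht
  obtain ⟨x₀, hc⟩ := h2 ν hν T hT v₀ u p hsol t ht
  exact scaleLaw_of_disp6_disp7 (h6 ν hν T hT v₀ u p hsol t ht x₀ hc) (h7 ν hν T hT v₀ u p hsol t ht x₀ hc)

/-- The literal face of Theorem 2.1 implies the charitable one (`R⁻ ≤ R`). [cite: Alneel2026, Thm 2.1 p.2 l.2–6] -/
theorem thm21_of_thm21_sup (C : ℝ) (h : Thm21_sup C) : Thm21 C := by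
  intro ν hν T hT v₀ u p hsol t ht
  have := h ν hν T hT v₀ u p hsol t ht
  refine le_trans ?_ this
  gcongr
  exact rinf_le_rsup _ _

/-- The abstract's inference implies the printed Point-3 tail (more hypotheses, same conclusion).
[cite: Alneel2026, abstract p.1 l.18–20; Point 3 p.3 l.28–49] -/
theorem p3tail_of_inference (C : ℝ) (h : Step_Thm31_inference C) : Step_P3tail C :=
  fun ν E₀ Ts X R hν hE hTs hXc hX0 h4 hsc _hrev hbl => h ν E₀ Ts X R hν hE hTs hXc hX0 h4 hsc hbl

/-- `E(w) ≥ 0` (a `toReal`). [cite: Alneel2026, Def 1.1 p.1 l.42–45] -/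
theorem energyF_nonneg (w : E3 → E3) : 0 ≤ energyF w := by
  unfold energyF; positivity

/-- `X(w) ≥ 0` (a `toReal`). [cite: Alneel2026, Def 1.1 p.1 l.46–49] -/
theorem xF_nonneg (w : E3 → E3) : 0 ≤ XF w := ENNReal.toReal_nonneg

/-! ### COMPOSITION — the printed chain composes (no BREAKS-AT-LOGIC) -/

/-- **COMPOSITION (abstract's face)**: Step 0 (dichotomy with `X → ∞`) → Step 1 (4) → Step 2 (5) → Step 3 (GN as
printed; expansion) → Step 4 (Hölder) → «Steps 3–4 ⇒ (6)» → (6) → (8) → «(6)+(8) ⇒ (7)» → (7) → [Thm 2.1 derived]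
→ Point 1 → Point 3 reverse → Point 3 tail ⇒ every datum has a global class solution. The kernel proof consumes
`h0`, `h1`, `h2`, `h6`, `h7`, `hP3`, `htail` (Theorem 2.1 enters through `thm21_of_steps`); the binders `_h3`,
`_h3x`, `_h4`, `_h6g`, `_h8`, `_h5b`, `_hP1` are the printed SUPPORT of (6)/(7)/Point 1, typed but not needed once
(6), (7) are granted as displayed. PURE LOGIC. [cite: Alneel2026, Thm 3.1 proof p.3 l.13–49; FIG. of §2 p.2] -/
theorem claimH_of_steps (C : ℝ) (h0 : Step0_dichotomy) (h1 : Step1_energy) (h2 : Step2_localisation)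
    (_h3 : Step3_GN_asPrinted C) (_h3x : Step3_expand) (_h4 : Step4_Holder) (_h6g : Step6_glue C)
    (h6 : Step6_display C) (_h8 : Step5a_exterior C) (_h5b : Step5b_inference C) (h7 : Step5_L21)
    (_hP1 : Step_P1 C) (hP3 : Step_P3rev C) (htail : Step_P3tail C) : ClaimedTheoremH := by
  intro ν hν v₀ hv₀
  rcases h0 ν hν v₀ hv₀ with hglob | ⟨Ts, hTs, u, p, hsol, hblow⟩
  · exact hglob
  · exfalso
    have h21 : Thm21 C := thm21_of_steps C h2 h6 h7
    obtain ⟨hcont, hE⟩ := h1 ν hν Ts hTs v₀ u p hsol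
    refine htail ν (energyF (u 0)) Ts (fun t => XF (u t)) (fun t => Rinf (energyF (u 0)) (u t)) hν
      (energyF_nonneg _) hTs hcont (fun t _ => xF_nonneg _) (fun t ht => ?_) (fun t ht => ?_)
      (fun t ht => ?_) hblow
    · obtain ⟨hid, hpos⟩ := hE t ht
      linarith
    · exact h21 ν hν Ts hTs v₀ u p hsol t ht
    · exact hP3 ν hν Ts hTs v₀ u p hsol t ht

/-- A smooth, divergence-free, compactly supported field is a datum of the class (compact support ⇒ rapid
decay (4) ⇒ every derivative in `L²`, tree lemmas). [cite: Alneel2026, §1 p.1 l.31–41]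
[cite: FeffermanClay2006, (4) p.1] -/
theorem isDatum_of_hasCompactSupport {v₀ : E3 → E3} (hs : ContDiff ℝ ∞ v₀)
    (hdiv : VectorCalculus.IsDivFree v₀) (hc : HasCompactSupport v₀) : IsDatum v₀ :=
  ⟨hs, hdiv, fun n =>
    (HasRapidSpatialDecay.of_hasCompactSupport hs hc).lintegral_enorm_iteratedFDeriv_sq_lt_top n⟩

/-- The abstract's face implies the printed (`C_c^∞`) face. [cite: Alneel2026, Thm 3.1 p.3 l.11–12; §1 p.1
l.31–41] -/
theorem claimed_of_claimedH (h : ClaimedTheoremH) : ClaimedTheorem :=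
  fun ν hν v₀ hs hdiv hc => h ν hν v₀ (isDatum_of_hasCompactSupport hs hdiv hc)

/-- **COMPOSITION (printed face, Theorem 3.1 with the data of p. 1)**: the same chain gives the printed headline.
[cite: Alneel2026, Thm 3.1 p.3 l.11–12] -/
theorem claim_of_steps (C : ℝ) (h0 : Step0_dichotomy) (h1 : Step1_energy) (h2 : Step2_localisation)
    (h3 : Step3_GN_asPrinted C) (h3x : Step3_expand) (h4 : Step4_Holder) (h6g : Step6_glue C)
    (h6 : Step6_display C) (h8 : Step5a_exterior C) (h5b : Step5b_inference C) (h7 : Step5_L21)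
    (hP1 : Step_P1 C) (hP3 : Step_P3rev C) (htail : Step_P3tail C) : ClaimedTheorem :=
  claimed_of_claimedH (claimH_of_steps C h0 h1 h2 h3 h3x h4 h6g h6 h8 h5b h7 hP1 hP3 htail)

/-! ### Clay link -/

/-- The abstract's face IS the C119 headline `Permana2026.ClaimedTheorem` (same class, same sentence shape).
[cite: Alneel2026, abstract p.1 l.15–24] -/
theorem claimedH_iff_permana : ClaimedTheoremH ↔ Permana2026.ClaimedTheorem := Iff.rfl

/-- **The abstract's face implies Clay (A)** (`ClayVariants.clayR3.Regularity`, token for token the summit body),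
through the C119 door `Permana2026.clay_of_claimed` (Clay datum ⇒ `IsDatum`; BKM-class global solution ⇒ smooth
on the closed half-space with bounded energy (7)). [cite: FeffermanClay2006, statement (A), CMI offprint p. 2] -/
theorem clay_of_claimedH (h : ClaimedTheoremH) : ClayVariants.clayR3.Regularity :=
  Permana2026.clay_of_claimed (claimedH_iff_permana.1 h)

/-- **The typed chain would give Clay (A)** (escalation grade if every step resisted: this composition decides
(A)). [cite: FeffermanClay2006, statement (A), CMI offprint p. 2] [cite: Alneel2026, Thm 3.1 p.3 l.11–12] -/
theorem clay_of_steps (C : ℝ) (h0 : Step0_dichotomy) (h1 : Step1_energy) (h2 : Step2_localisation)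
    (h3 : Step3_GN_asPrinted C) (h3x : Step3_expand) (h4 : Step4_Holder) (h6g : Step6_glue C)
    (h6 : Step6_display C) (h8 : Step5a_exterior C) (h5b : Step5b_inference C) (h7 : Step5_L21)
    (hP1 : Step_P1 C) (hP3 : Step_P3rev C) (htail : Step_P3tail C) : ClayVariants.clayR3.Regularity :=
  clay_of_claimedH (claimH_of_steps C h0 h1 h2 h3 h3x h4 h6g h6 h8 h5b h7 hP1 hP3 htail)

/-- **Printed face + Δ4 ⇒ Clay (A)**: with the printed identification of the Clay data with `C_c^∞`
(`ClayDelta`, false), the printed headline would give (A). [cite: Alneel2026, §1 p.1 l.31–41]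
[cite: FeffermanClay2006, statement (A) with (4), CMI offprint pp. 1–2] -/
theorem clay_of_claimed_of_delta (hΔ : ClayDelta) (h : ClaimedTheorem) : ClayVariants.clayR3.Regularity :=
  clay_of_claimedH fun ν hν v₀ hv₀ => h ν hν v₀ hv₀.1 hv₀.2.1 (hΔ v₀ hv₀)

/-! ### D-0026 in-file discharges of TRUE printed steps (rev 2, append-only; statements above byte-identical)

Step 4 (Hölder on the ball) and Point 1 are TRUE as typed; they are SUPPORT binders of `claim_of_steps`
(unconsumed by the kernel composition), so these discharges move no token and no class. -/

/-- Cauchy–Schwarz in lower-integral form, measurability-free: `(∫⁻ F dμ)² ≤ μ(univ) · ∫⁻ F² dμ` (a measurable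
minorant `g ≤ F` with the same integral exists, `exists_measurable_le_lintegral_eq`; Hölder with exponents
(2, 2) for `g · 1`; `g² ≤ F²`). [folklore] -/
private theorem lintegral_sq_le_mul_lintegral_sq {μ : Measure E3} (F : E3 → ℝ≥0∞) :
    (∫⁻ y, F y ∂μ) ^ 2 ≤ μ univ * ∫⁻ y, F y ^ 2 ∂μ := by
  obtain ⟨g, hgm, hgle, hgeq⟩ := exists_measurable_le_lintegral_eq (μ := μ) F
  have hcs := ENNReal.lintegral_mul_le_Lp_mul_Lq μ Real.HolderConjugate.two_two hgm.aemeasurable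
    (aemeasurable_const (b := (1 : ℝ≥0∞)))
  simp only [Pi.mul_apply, mul_one, ENNReal.one_rpow, lintegral_const, one_mul] at hcs
  -- square both sides
  have hsq : (∫⁻ a, g a ∂μ) ^ 2 ≤ ((∫⁻ a, g a ^ (2:ℝ) ∂μ) ^ (1 / (2:ℝ)) * (μ univ) ^ (1 / (2:ℝ))) ^ 2 :=
    pow_le_pow_left' hcs 2
  have hrhs : ((∫⁻ a, g a ^ (2:ℝ) ∂μ) ^ (1 / (2:ℝ)) * (μ univ) ^ (1 / (2:ℝ))) ^ 2
      = (∫⁻ a, g a ^ (2:ℝ) ∂μ) * μ univ := by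
    rw [mul_pow, ← ENNReal.rpow_natCast, ← ENNReal.rpow_natCast, ← ENNReal.rpow_mul,
      ← ENNReal.rpow_mul]
    norm_num
  rw [hgeq]
  calc (∫⁻ a, g a ∂μ) ^ 2 ≤ (∫⁻ a, g a ^ (2:ℝ) ∂μ) * μ univ := by rw [← hrhs]; exact hsq
    _ ≤ (∫⁻ a, F a ^ 2 ∂μ) * μ univ := by
        gcongr with a
        rw [ENNReal.rpow_two]
        exact pow_le_pow_left' (hgle a) 2
    _ = μ univ * ∫⁻ y, F y ^ 2 ∂μ := mul_comm _ _

/-- **Step 4 — p. 2 l. 33–42 «By Hölder on B_R: ‖v‖⁴_{L⁴} ≥ |B_R|⁻¹‖v‖⁴_{L²}» is TRUE as typed** (D-0026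
discharge; Cauchy–Schwarz on `B(x₀,R)` for `F = |v|²`, then `∫⁻_{B}|v|⁴ ≤ ∫⁻_{ℝ³}|v|⁴`).
[cite: Alneel2026, Step 4 p.2 l.33–42] -/
theorem step4_Holder_holds : Step4_Holder := by
  intro v x₀ R _hR
  have h := lintegral_sq_le_mul_lintegral_sq (μ := volume.restrict (ball x₀ R)) (fun y => ‖v y‖ₑ ^ 2)
  rw [Measure.restrict_apply_univ] at h
  refine h.trans (mul_le_mul_right ?_ _)
  calc ∫⁻ y in ball x₀ R, (‖v y‖ₑ ^ 2) ^ 2 ≤ ∫⁻ y, (‖v y‖ₑ ^ 2) ^ 2 :=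
        lintegral_mono' Measure.restrict_le_self le_rfl
    _ = ∫⁻ y, ‖v y‖ₑ ^ 4 := by
        refine lintegral_congr fun y => ?_
        ring


/-- **Point 1 — p. 3 l. 16–20 «From Theorem 2.1, R(t)² ≤ 16C_GN E₀/X(t). Thus if X(t) → ∞ then R(t) → 0» is TRUE
as typed** (D-0026 discharge, every `C`): eventually `R(t)² ≤ c / X(t)` with `c = 16·C·E₀ < ∞` and
`X(t) → ∞`, so `R(t)² → 0`, hence `R(t) = (R(t)²)^{1/2} → 0`. [cite: Alneel2026, Point 1 p.3 l.16–20] -/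
theorem step_P1_holds (C : ℝ) : Step_P1 C := by
  intro E₀ Ts X R hTs hsc hX
  set c : ℝ≥0∞ := ENNReal.ofReal (16 * C * E₀) with hc
  -- `c / X(t) → 0`
  have hXe : Tendsto (fun t => ENNReal.ofReal (X t)) (𝓝[<] Ts) (𝓝 ⊤) :=
    ENNReal.tendsto_ofReal_atTop.comp hX
  have hdiv : Tendsto (fun t => c / ENNReal.ofReal (X t)) (𝓝[<] Ts) (𝓝 0) := by
    have := ENNReal.Tendsto.const_div (a := c) hXe (Or.inr (by rw [hc]; exact ENNReal.ofReal_ne_top))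
    simpa [ENNReal.div_top] using this
  -- eventually `R(t)² ≤ c / X(t)`
  have hev : ∀ᶠ t in 𝓝[<] Ts, R t ^ 2 ≤ c / ENNReal.ofReal (X t) := by
    filter_upwards [Ioo_mem_nhdsLT hTs, hX.eventually_ge_atTop 1] with t ht hXt
    have hpos : ENNReal.ofReal (X t) ≠ 0 := by
      rw [ne_eq, ENNReal.ofReal_eq_zero, not_le]; linarith
    exact (ENNReal.le_div_iff_mul_le (Or.inl hpos) (Or.inl ENNReal.ofReal_ne_top)).2
      (hsc t ⟨ht.1.le, ht.2⟩)
  have hsq : Tendsto (fun t => R t ^ 2) (𝓝[<] Ts) (𝓝 0) :=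
    tendsto_of_tendsto_of_tendsto_of_le_of_le' tendsto_const_nhds hdiv
      (Eventually.of_forall fun t => (zero_le : (0:ℝ≥0∞) ≤ R t ^ 2)) hev
  -- take square roots
  have hroot : Tendsto (fun t => (R t ^ 2) ^ (1 / 2 : ℝ)) (𝓝[<] Ts) (𝓝 ((0:ℝ≥0∞) ^ (1 / 2 : ℝ))) :=
    (ENNReal.continuous_rpow_const.tendsto 0).comp hsq
  have h0 : (0:ℝ≥0∞) ^ (1 / 2 : ℝ) = 0 := by simp
  rw [h0] at hroot
  refine hroot.congr fun t => ?_
  rw [← ENNReal.rpow_natCast, ← ENNReal.rpow_mul]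
  norm_num


section Step1Discharge

open scoped InnerProductSpace Laplacian

/-! ### Step 1 discharged (rev 3): the energy identity (4) and the continuity of `X` in the class -/

/-- `L²` membership of a continuous field from a finite lower integral `∫⁻ ‖f‖ₑ² < ∞`. [folklore] -/
private theorem memLp_two_of_lintegral_lt_top {F : Type*} [NormedAddCommGroup F] {f : E3 → F}
    (hf : Continuous f) (h : ∫⁻ x, ‖f x‖ₑ ^ 2 < ⊤) : MemLp f 2 volume :=
  (memLp_two_iff_integrable_sq_norm hf.aestronglyMeasurable).2 (integrable_sq_norm_of_lintegral_lt_top hf h)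

/-- Inner products of two `L²` fields are integrable. [folklore] -/
private theorem integrable_inner_of_memLp_two {f g : E3 → E3} (hf : MemLp f 2 volume)
    (hg : MemLp g 2 volume) : Integrable (fun x => ⟪f x, g x⟫_ℝ) volume := by
  refine (hf.norm.integrable_mul hg.norm).mono' (hf.1.inner hg.1) (Eventually.of_forall fun x => ?_)
  rw [Real.norm_eq_abs]
  simpa using abs_real_inner_le_norm (f x) (g x)

/-- `‖Δv(x)‖ ≤ 3‖D²v(x)‖` on `ℝ³` (the Laplacian is the trace of the Hessian). [folklore] -/
private theorem norm_laplacian_le (v : E3 → E3) (x : E3) :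
    ‖(Δ v) x‖ ≤ 3 * ‖iteratedFDeriv ℝ 2 v x‖ := by
  have hb := congrFun (InnerProductSpace.laplacian_eq_iteratedFDeriv_orthonormalBasis v (EuclideanSpace.basisFun (Fin 3) ℝ)) x
  rw [hb]
  calc ‖∑ i, iteratedFDeriv ℝ 2 v x ![EuclideanSpace.basisFun (Fin 3) ℝ i, EuclideanSpace.basisFun (Fin 3) ℝ i]‖
      ≤ ∑ i, ‖iteratedFDeriv ℝ 2 v x ![EuclideanSpace.basisFun (Fin 3) ℝ i, EuclideanSpace.basisFun (Fin 3) ℝ i]‖ :=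
        norm_sum_le _ _
    _ ≤ ∑ _i : Fin 3, ‖iteratedFDeriv ℝ 2 v x‖ := Finset.sum_le_sum fun i _ => by
        calc ‖iteratedFDeriv ℝ 2 v x ![EuclideanSpace.basisFun (Fin 3) ℝ i, EuclideanSpace.basisFun (Fin 3) ℝ i]‖
            ≤ ‖iteratedFDeriv ℝ 2 v x‖ *
                ∏ j, ‖(![EuclideanSpace.basisFun (Fin 3) ℝ i, EuclideanSpace.basisFun (Fin 3) ℝ i] : Fin 2 → E3) j‖ :=
              ContinuousMultilinearMap.le_opNorm _ _
          _ = ‖iteratedFDeriv ℝ 2 v x‖ := by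
              simp [Fin.prod_univ_two]
    _ = 3 * ‖iteratedFDeriv ℝ 2 v x‖ := by
        simp [Finset.sum_const, Finset.card_univ, Fintype.card_fin]

/-- **The slice identity `∫|∇v|²_F = ∫|curl v|²`** for a smooth divergence-free field on `ℝ³` with
`v, Dv, D²v ∈ L²`: Green's identity `∫|∇v|²_F = −∫⟪v,Δv⟫`
(`wholeSpace_integral_frobeniusNormSq_fderiv_eq_neg_integral_inner_laplacian`), the self-adjointness of
the curl on integrable pairs `∫⟪curl v, curl v⟫ = ∫⟪v, curl curl v⟫`
(`FarhatGrujic2018.integral_inner_curl_eq_integral_inner_curl_of_integrable`) and `curl curl v = −Δv`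
(`curl_curl_eq_neg_laplacian`). [cite: MajdaBertozziCUP2002, Prop. 2.16 (proof)] -/
private theorem integral_frobeniusNormSq_eq_integral_curl_sq {v : E3 → E3} (hv : ContDiff ℝ ∞ v)
    (hdiv : VectorCalculus.IsDivFree v) (h0 : ∫⁻ x, ‖v x‖ₑ ^ 2 < ⊤)
    (h1 : ∫⁻ x, ‖iteratedFDeriv ℝ 1 v x‖ₑ ^ 2 < ⊤) (h2 : ∫⁻ x, ‖iteratedFDeriv ℝ 2 v x‖ₑ ^ 2 < ⊤) :
    ∫ x, frobeniusNormSq (fderiv ℝ v x) = ∫ x, ‖curl v x‖ ^ 2 := by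
  have hv2 : ContDiff ℝ 2 v := hv.of_le (by norm_cast)
  have hv1 : ContDiff ℝ 1 v := hv.of_le (by norm_cast)
  have hc1 : ContDiff ℝ 1 (curl v) := contDiff_curl (n := 1) (hv.of_le (by norm_cast))
  -- `L²` memberships of `v`, `Dv`, `D²v`, `curl v`, `Δv`
  have m0 : MemLp v 2 volume := memLp_two_of_lintegral_lt_top hv.continuous h0
  have h1' : ∫⁻ x, ‖fderiv ℝ v x‖ₑ ^ 2 < ⊤ := by
    refine lt_of_le_of_lt (le_of_eq (lintegral_congr fun x => ?_)) h1
    rw [← ofReal_norm, ← norm_iteratedFDeriv_one (𝕜 := ℝ) (f := v), ofReal_norm]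
  have m1 : MemLp (fun x => fderiv ℝ v x) 2 volume :=
    memLp_two_of_lintegral_lt_top (hv1.continuous_fderiv one_ne_zero) h1'
  have m2 : MemLp (fun x => iteratedFDeriv ℝ 2 v x) 2 volume :=
    memLp_two_of_lintegral_lt_top (hv.continuous_iteratedFDeriv (m := 2) (by norm_cast)) h2
  have mc : MemLp (curl v) 2 volume :=
    m1.of_le_mul (c := ‖curlCLM‖) (continuous_curl hv1).aestronglyMeasurable
      (Eventually.of_forall fun x => norm_curl_le v x)
  have mΔ : MemLp (fun x => (Δ v) x) 2 volume :=
    m2.of_le_mul (c := 3) (continuous_laplacian hv2).aestronglyMeasurable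
      (Eventually.of_forall fun x => norm_laplacian_le v x)
  have mcc : MemLp (curl (curl v)) 2 volume := by
    have : curl (curl v) = fun x => -(Δ v) x := funext fun x => curl_curl_eq_neg_laplacian hv2 hdiv x
    rw [this]; exact mΔ.neg
  -- Green: `∫|∇v|² = −∫⟪v, Δv⟫`
  have hG := wholeSpace_integral_frobeniusNormSq_fderiv_eq_neg_integral_inner_laplacian hv2 m0 m1 m2
  -- the curl is self-adjoint on the integrable pair `(v, curl v)`
  have hX : Integrable (fun y => cross (curl v y) (v y)) := by
    refine (mc.norm.integrable_mul m0.norm).mono'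
      ((crossCLM.continuous₂.comp ((continuous_curl hv1).prodMk hv.continuous)).aestronglyMeasurable)
      (Eventually.of_forall fun x => ?_)
    simp only [Pi.mul_apply]
    calc ‖cross (curl v x) (v x)‖
        = ‖curl v x‖ * ‖v x‖ * Real.sin (InnerProductGeometry.angle (curl v x) (v x)) := norm_cross _ _
      _ ≤ ‖curl v x‖ * ‖v x‖ * 1 := by gcongr; exact Real.sin_le_one _
      _ = ‖curl v x‖ * ‖v x‖ := mul_one _
  have hIBP := FarhatGrujic2018.integral_inner_curl_eq_integral_inner_curl_of_integrable hv1 hc1 hX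
    (integrable_inner_of_memLp_two m0 mcc) (integrable_inner_of_memLp_two mc mc)
  -- assemble
  calc ∫ x, frobeniusNormSq (fderiv ℝ v x) = - ∫ x, ⟪v x, (Δ v) x⟫_ℝ := hG
    _ = ∫ x, ⟪v x, curl (curl v) x⟫_ℝ := by
        rw [← integral_neg]
        refine integral_congr_ae (Eventually.of_forall fun x => ?_)
        simp only [curl_curl_eq_neg_laplacian hv2 hdiv x, inner_neg_right]
    _ = ∫ x, ⟪curl v x, curl v x⟫_ℝ := hIBP.symm
    _ = ∫ x, ‖curl v x‖ ^ 2 := integral_congr_ae (Eventually.of_forall fun x => real_inner_self_eq_norm_sq _)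

/-- The `[0,∞]`-valued form of the slice identity: `XeF v = ∫⁻ ‖curl v‖ₑ²` (both finite).
[cite: MajdaBertozziCUP2002, Prop. 2.16 (proof)] -/
private theorem xeF_eq_lintegral_curl_sq {v : E3 → E3} (hv : ContDiff ℝ ∞ v)
    (hdiv : VectorCalculus.IsDivFree v) (h0 : ∫⁻ x, ‖v x‖ₑ ^ 2 < ⊤)
    (h1 : ∫⁻ x, ‖iteratedFDeriv ℝ 1 v x‖ₑ ^ 2 < ⊤) (h2 : ∫⁻ x, ‖iteratedFDeriv ℝ 2 v x‖ₑ ^ 2 < ⊤) :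
    XeF v = ∫⁻ x, ‖curl v x‖ₑ ^ 2 := by
  have hv1 : ContDiff ℝ 1 v := hv.of_le (by norm_cast)
  have hv2 : ContDiff ℝ 2 v := hv.of_le (by norm_cast)
  -- integrability of both densities
  have h1' : ∫⁻ x, ‖fderiv ℝ v x‖ₑ ^ 2 < ⊤ := by
    refine lt_of_le_of_lt (le_of_eq (lintegral_congr fun x => ?_)) h1
    rw [← ofReal_norm, ← norm_iteratedFDeriv_one (𝕜 := ℝ) (f := v), ofReal_norm]
  have hfin : XeF v < ⊤ := by
    refine lt_of_le_of_lt (lintegral_mono fun x => ofReal_frobeniusNormSq_le (fderiv ℝ v x)) ?_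
    rw [lintegral_const_mul' _ _ (by norm_num)]
    exact ENNReal.mul_lt_top (by norm_num) h1'
  have hS : Continuous fun x => frobeniusNormSq (fderiv ℝ v x) := continuous_frobeniusNormSq_fderiv hv2 (by norm_num)
  have hintF : Integrable fun x => frobeniusNormSq (fderiv ℝ v x) := by
    refine ⟨hS.aestronglyMeasurable, (hasFiniteIntegral_iff_enorm).2 ?_⟩
    refine lt_of_le_of_lt (le_of_eq (lintegral_congr fun x => ?_)) hfin
    rw [Real.enorm_eq_ofReal (frobeniusNormSq_nonneg _)]
  have hcurl : ∫⁻ x, ‖curl v x‖ₑ ^ 2 < ⊤ :=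
    lt_of_le_of_lt ((lintegral_curl_sq_le v).trans le_rfl)
      (ENNReal.mul_lt_top ENNReal.ofReal_lt_top h1)
  have hintC : Integrable fun x => ‖curl v x‖ ^ 2 :=
    integrable_sq_norm_of_lintegral_lt_top (continuous_curl hv1) hcurl
  unfold XeF
  rw [← ofReal_integral_eq_lintegral_ofReal hintF (ae_of_all _ fun x => frobeniusNormSq_nonneg _),
    integral_frobeniusNormSq_eq_integral_curl_sq hv hdiv h0 h1 h2, ofReal_integral_sq_norm hintC]

/-- Along a class solution on `[0,T)`, every slice `u s`, `s ∈ [0,T)`, has `Dⁿu(s) ∈ L²` for all `n`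
(the Sobolev bounds on the closed sub-slab `[0,s]`). [folklore] -/
private theorem lintegral_iteratedFDeriv_slice_lt_top {ν T : ℝ} {v₀ : E3 → E3} {u : ℝ → E3 → E3}
    {p : ℝ → E3 → ℝ} (hsol : IsLocalSolution ν T v₀ u p) {s : ℝ} (hs : s ∈ Ico 0 T) (n : ℕ) :
    ∫⁻ x, ‖iteratedFDeriv ℝ n (u s) x‖ₑ ^ 2 < ⊤ := by
  obtain ⟨C, hC⟩ := hsol.sobolev s hs.2 n
  exact (hC s ⟨hs.1, le_rfl⟩).trans_lt ENNReal.coe_lt_top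

/-- Along a class solution, `X(s) = ∫ ‖curl u(s)‖²` for `s ∈ [0,T)`. [cite: MajdaBertozziCUP2002, Prop. 2.16 (proof)] -/
private theorem xF_eq_integral_curl_sq {ν T : ℝ} {v₀ : E3 → E3} {u : ℝ → E3 → E3}
    {p : ℝ → E3 → ℝ} (hsol : IsLocalSolution ν T v₀ u p) {s : ℝ} (hs : s ∈ Ico 0 T) :
    XF (u s) = ∫ x, ‖curl (u s) x‖ ^ 2 := by
  have hsm : ContDiff ℝ ∞ (u s) := hsol.isClassical.contDiff_velocity hs
  have h0 : ∫⁻ x, ‖u s x‖ₑ ^ 2 < ⊤ := by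
    refine lt_of_le_of_lt (le_of_eq (lintegral_congr fun x => ?_)) (lintegral_iteratedFDeriv_slice_lt_top hsol hs 0)
    rw [← ofReal_norm, ← norm_iteratedFDeriv_zero (𝕜 := ℝ) (f := u s), ofReal_norm]
  have hcurl : ∫⁻ x, ‖curl (u s) x‖ₑ ^ 2 < ⊤ :=
    lt_of_le_of_lt (lintegral_curl_sq_le (u s))
      (ENNReal.mul_lt_top ENNReal.ofReal_lt_top (lintegral_iteratedFDeriv_slice_lt_top hsol hs 1))
  have hintC : Integrable fun x => ‖curl (u s) x‖ ^ 2 :=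
    integrable_sq_norm_of_lintegral_lt_top (continuous_curl (hsm.of_le (by norm_cast))) hcurl
  unfold XF
  rw [xeF_eq_lintegral_curl_sq hsm (hsol.isClassical.divFree s hs) h0
    (lintegral_iteratedFDeriv_slice_lt_top hsol hs 1) (lintegral_iteratedFDeriv_slice_lt_top hsol hs 2),
    ← ofReal_integral_sq_norm hintC, ENNReal.toReal_ofReal (integral_nonneg fun x => sq_nonneg _)]

/-- **Step 1 holds — (4) p. 2 l. 7–14 / Point 2 p. 3 l. 21–24**: along every class solution on `[0,T)`,
`t ↦ X(t)` is continuous on `[0,T)` and `E(t) + ν∫₀ᵗX(s)ds = E(0)`, `0 ≤ E(t)`. The identity is the tree's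
energy equality for finite-energy classical solutions on closed slabs
(`IsClassicalNSSolutionOn.energyEq_finiteEnergy`, Tao 2013 Lemma 8.1 = Leray 1934 (3.4)) applied on
`[0,(t+T)/2]`, with the finite energy read off the order-`0` Sobolev bound of the class; the continuity of
`X` is the continuity of the enstrophy in the Beale–Kato–Majda class
(`IsClassicalNSSolutionOn.continuousOn_integral_norm_curl_sq_Ico`, Majda–Bertozzi Thm. 3.5) transported
through the slice identity `∫|∇u(s)|²_F = ∫|curl u(s)|²` for divergence-free slices with `u, Du, D²u ∈ L²`.
[cite: Alneel2026, Step 1 (4) p.2 l.7–14; Point 2 p.3 l.21–24] [cite: Leray1934, (2.18)]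
[cite: Tao2011, Lemma 8.1] [cite: MajdaBertozziCUP2002, §3.2.2 Thm. 3.5 (PDF p. 92)] -/
theorem step1_energy_holds : Step1_energy := by
  intro ν hν T hT v₀ u p hsol
  have hS : IsClassicalNSSolutionOn (Ico 0 T) ν 0 u p := hsol.isClassical
  -- continuity of `X` on `[0,T)`
  have hcont : ContinuousOn (fun t => XF (u t)) (Ico 0 T) :=
    (hS.continuousOn_integral_norm_curl_sq_Ico hsol.sobolev).congr fun s hs => xF_eq_integral_curl_sq hsol hs
  refine ⟨hcont, fun t ht => ⟨?_, energyF_nonneg _⟩⟩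
  -- the closed sub-slab `[0, T'']`, `T'' = (t+T)/2`
  set T'' : ℝ := (t + T) / 2 with hT''def
  have hT''T : T'' < T := by rw [hT''def]; linarith [ht.2]
  have htT'' : t < T'' := by rw [hT''def]; linarith [ht.2]
  have hT''pos : 0 < T'' := lt_of_le_of_lt ht.1 htT''
  have hsub : Icc (0 : ℝ) T'' ⊆ Ico 0 T := fun s hs => ⟨hs.1, lt_of_le_of_lt hs.2 hT''T⟩
  have hS'' : IsClassicalNSSolutionOn (Icc 0 T'') ν 0 u p := hS.mono hsub (uniqueDiffOn_Icc hT''pos)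
  have hB : HasBoundedSobolevNormsOn (Icc 0 T'') u := hsol.sobolev T'' hT''T
  -- finite energy on the slab
  obtain ⟨C₀, hC₀⟩ := hB 0
  have hE0 : ∀ s ∈ Icc 0 T'', ∫⁻ x, ‖u s x‖ₑ ^ 2 ≤ C₀ := fun s hs =>
    (le_of_eq (lintegral_congr fun x => by
      rw [← ofReal_norm, ← norm_iteratedFDeriv_zero (𝕜 := ℝ) (f := u s), ofReal_norm])).trans (hC₀ s hs)
  have hfe : ∃ A : ℝ≥0∞, A < ⊤ ∧ ∀ s ∈ Icc 0 T'', ∫⁻ x, ‖u s x‖ₑ ^ 2 ≤ A :=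
    ⟨C₀, ENNReal.coe_lt_top, hE0⟩
  -- the tree's energy equality on `[0, t] ⊆ [0, T'']`
  have hEq := hS''.energyEq_finiteEnergy hν hT''pos hfe le_rfl ht.1 htT''.le
  -- `kineticEnergy = energyF` on the slab
  have hKE : ∀ s ∈ Icc 0 T'', VectorCalculus.kineticEnergy (u s) = energyF (u s) := by
    intro s hs
    have hint : Integrable fun x => ‖u s x‖ ^ 2 :=
      integrable_sq_norm_of_lintegral_lt_top (hS''.contDiff_velocity hs).continuous
        ((hE0 s hs).trans_lt ENNReal.coe_lt_top)
    simp only [VectorCalculus.kineticEnergy, energyF, ← ofReal_integral_sq_norm hint,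
      ENNReal.toReal_ofReal (integral_nonneg fun x => sq_nonneg _)]
    norm_num
  -- finiteness and measurability of the slice dissipation on `(0, t)`
  obtain ⟨C₁, hC₁⟩ := hB 1
  have hXe_le : ∀ s ∈ Icc 0 T'', XeF (u s) ≤ 3 * C₁ := by
    intro s hs
    calc XeF (u s) ≤ ∫⁻ x, 3 * ‖fderiv ℝ (u s) x‖ₑ ^ 2 :=
          lintegral_mono fun x => ofReal_frobeniusNormSq_le (fderiv ℝ (u s) x)
      _ = 3 * ∫⁻ x, ‖iteratedFDeriv ℝ 1 (u s) x‖ₑ ^ 2 := by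
          rw [lintegral_const_mul' _ _ (by norm_num)]
          congr 1
          exact lintegral_congr fun x => by
            rw [← ofReal_norm, ← norm_iteratedFDeriv_one (𝕜 := ℝ) (f := u s), ofReal_norm]
      _ ≤ 3 * C₁ := by gcongr; exact hC₁ s hs
  have hXe_eq : ∀ s ∈ Icc 0 T'', XeF (u s) = ENNReal.ofReal (XF (u s)) := by
    intro s hs
    rw [XF, ENNReal.ofReal_toReal]
    exact ((hXe_le s hs).trans_lt (ENNReal.mul_lt_top (by norm_num) ENNReal.coe_lt_top)).ne
  have hIoo : Ioo (0 : ℝ) t ⊆ Icc 0 T'' := fun s hs => ⟨hs.1.le, hs.2.le.trans htT''.le⟩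
  have hmeas : AEMeasurable (fun s => XeF (u s)) (volume.restrict (Ioo 0 t)) := by
    have hc : ContinuousOn (fun s => ENNReal.ofReal (XF (u s))) (Ioo 0 t) :=
      ENNReal.continuous_ofReal.comp_continuousOn (hcont.mono fun s hs => ⟨hs.1.le, hs.2.trans_le htT''.le |>.trans hT''T⟩)
    refine (hc.aemeasurable measurableSet_Ioo).congr ?_
    exact (ae_restrict_mem measurableSet_Ioo).mono fun s hs => (hXe_eq s (hIoo hs)).symm
  have hdiss : ∫ s in (0:ℝ)..t, XF (u s) =
      (∫⁻ s in Ioo 0 t, XeF (u s)).toReal := by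
    rw [intervalIntegral.integral_of_le ht.1, integral_Ioc_eq_integral_Ioo]
    simp only [XF]
    exact integral_toReal hmeas ((ae_restrict_mem measurableSet_Ioo).mono fun s hs =>
      (hXe_le s (hIoo hs)).trans_lt (ENNReal.mul_lt_top (by norm_num) ENNReal.coe_lt_top))
  -- assemble
  rw [hdiss, ← hKE t ⟨ht.1, htT''.le⟩, ← hKE 0 ⟨le_rfl, hT''pos.le⟩]
  simpa only [XeF] using hEq

end Step1Discharge

section Step3ExpandDischarge

open scoped InnerProductSpace

/-! ### Step 3 expansion clause discharged (rev 4, typist-3 g7; D-0026 records-grade)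

APPEND-ONLY: lines 1–962 of rev 3 (p534527) are byte-identical; no keyed decl is touched (head of record #145
`Step_P3tail`, RECORDED face `Step6_display`). `Step3_expand` is the unconsumed SUPPORT binder `_h3x` of
`claimH_of_steps`; its discharge moves no token and no class.

WHAT THIS IS NOT: not a claim about NS regularity or blow-up; not a claim about any author beyond the typed
locator. -/


/-- `√|L|²_F` is the Euclidean norm of the vector `(‖L eᵢ‖)ᵢ`. [folklore] -/
private theorem sqrt_frobeniusNormSq_eq_norm (L : E3 →L[ℝ] E3) :
    Real.sqrt (frobeniusNormSq L) =
      ‖(WithLp.toLp 2 fun i => ‖L (stdOrthonormalBasis ℝ E3 i)‖ :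
        EuclideanSpace ℝ (Fin (Module.finrank ℝ E3)))‖ := by
  rw [EuclideanSpace.norm_eq]
  unfold frobeniusNormSq
  congr 1
  refine Finset.sum_congr rfl fun i _ => ?_
  rw [PiLp.toLp_apply, Real.norm_eq_abs, sq_abs]

/-- Hilbert–Schmidt triangle inequality `√|A+B|²_F ≤ √|A|²_F + √|B|²_F`. [folklore] -/
private theorem sqrt_frobeniusNormSq_add_le (A B : E3 →L[ℝ] E3) :
    Real.sqrt (frobeniusNormSq (A + B)) ≤
      Real.sqrt (frobeniusNormSq A) + Real.sqrt (frobeniusNormSq B) := by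
  set a : EuclideanSpace ℝ (Fin (Module.finrank ℝ E3)) :=
    WithLp.toLp 2 fun i => ‖A (stdOrthonormalBasis ℝ E3 i)‖ with ha
  set c : EuclideanSpace ℝ (Fin (Module.finrank ℝ E3)) :=
    WithLp.toLp 2 fun i => ‖B (stdOrthonormalBasis ℝ E3 i)‖ with hc
  have hAB : Real.sqrt (frobeniusNormSq (A + B)) ≤ ‖a + c‖ := by
    rw [EuclideanSpace.norm_eq]
    refine Real.sqrt_le_sqrt ?_
    unfold frobeniusNormSq
    refine Finset.sum_le_sum fun i _ => ?_
    have h1 : ‖(A + B) (stdOrthonormalBasis ℝ E3 i)‖ ≤ ‖(a + c) i‖ := by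
      rw [_root_.add_apply, PiLp.add_apply, ha, hc, PiLp.toLp_apply, PiLp.toLp_apply,
        Real.norm_eq_abs, abs_of_nonneg (add_nonneg (norm_nonneg _) (norm_nonneg _))]
      exact norm_add_le _ _
    exact pow_le_pow_left₀ (norm_nonneg _) h1 2
  calc Real.sqrt (frobeniusNormSq (A + B)) ≤ ‖a + c‖ := hAB
    _ ≤ ‖a‖ + ‖c‖ := norm_add_le a c
    _ = Real.sqrt (frobeniusNormSq A) + Real.sqrt (frobeniusNormSq B) := by
        rw [sqrt_frobeniusNormSq_eq_norm A, sqrt_frobeniusNormSq_eq_norm B]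

/-- `|c • L|²_F = c² |L|²_F`. [folklore] -/
private theorem frobeniusNormSq_smul_left (c : ℝ) (L : E3 →L[ℝ] E3) :
    frobeniusNormSq (c • L) = c ^ 2 * frobeniusNormSq L := by
  unfold frobeniusNormSq
  rw [Finset.mul_sum]
  refine Finset.sum_congr rfl fun i _ => ?_
  rw [_root_.smul_apply, norm_smul, mul_pow, Real.norm_eq_abs, sq_abs]

/-- Rank-one bound: `√|f ⊗ z|²_F ≤ ‖f‖·‖z‖` for the map `v ↦ f(v)•z` (Bessel for the Riesz vector of `f`).
[folklore] -/
private theorem sqrt_frobeniusNormSq_smulRight_le (f : E3 →L[ℝ] ℝ) (z : E3) :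
    Real.sqrt (frobeniusNormSq (f.smulRight z)) ≤ ‖f‖ * ‖z‖ := by
  have hsum : frobeniusNormSq (f.smulRight z) =
      (∑ i, f (stdOrthonormalBasis ℝ E3 i) ^ 2) * ‖z‖ ^ 2 := by
    unfold frobeniusNormSq
    rw [Finset.sum_mul]
    refine Finset.sum_congr rfl fun i _ => ?_
    rw [ContinuousLinearMap.smulRight_apply, norm_smul, mul_pow, Real.norm_eq_abs, sq_abs]
  -- Bessel: `Σ (f eᵢ)² ≤ ‖f‖²`
  have hB : ∑ i, f (stdOrthonormalBasis ℝ E3 i) ^ 2 ≤ ‖f‖ ^ 2 := by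
    set y : E3 := (InnerProductSpace.toDual ℝ E3).symm f with hy
    have hf : ∀ v, f v = ⟪y, v⟫_ℝ := fun v => by
      rw [hy, InnerProductSpace.toDual_symm_apply]
    have hnorm : ‖y‖ = ‖f‖ := by rw [hy]; exact LinearIsometryEquiv.norm_map _ _
    calc ∑ i, f (stdOrthonormalBasis ℝ E3 i) ^ 2
        = ∑ i, ‖⟪stdOrthonormalBasis ℝ E3 i, y⟫_ℝ‖ ^ 2 := by
          refine Finset.sum_congr rfl fun i _ => ?_
          rw [hf, real_inner_comm, Real.norm_eq_abs, sq_abs]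
      _ ≤ ‖y‖ ^ 2 := (stdOrthonormalBasis ℝ E3).orthonormal.sum_inner_products_le y
      _ = ‖f‖ ^ 2 := by rw [hnorm]
  rw [hsum, Real.sqrt_le_left (mul_nonneg (norm_nonneg _) (norm_nonneg _)), mul_pow]
  exact mul_le_mul_of_nonneg_right hB (sq_nonneg _)

/-- A cut-off of Step 2 has vanishing derivative off the open ball `B(x₀, 2R)` (every such point is a
global minimum of `φ ≥ 0`). [folklore] -/
private theorem fderiv_cutoff_eq_zero {x₀ : E3} {R : ℝ} {φ : E3 → ℝ} (hφ : IsCutoff x₀ R φ) {x : E3}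
    (hx : x ∉ ball x₀ (2 * R)) : fderiv ℝ φ x = 0 := by
  refine IsLocalMin.fderiv_eq_zero (Filter.Eventually.of_forall fun y => ?_)
  rw [hφ.2.2.1 x hx]
  exact (hφ.2.2.2.1 y).1

/-- The pointwise expansion behind Step 3 p. 2 l. 29–32: for a differentiable `w` and a cut-off `φ`,
`|∇(φw)(x)|_F ≤ 𝟙_{B_{2R}}(x)|∇w(x)|_F + (2/R)𝟙_{B_{2R}}(x)|w(x)|`. [cite: Alneel2026, Step 3 p.2 l.29–32] -/
private theorem sqrt_frobeniusNormSq_fderiv_smul_le {w : E3 → E3} (hw : Differentiable ℝ w) {x₀ : E3}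
    {R : ℝ} {φ : E3 → ℝ} (hφ : IsCutoff x₀ R φ) (x : E3) :
    Real.sqrt (frobeniusNormSq (fderiv ℝ (fun y => φ y • w y) x)) ≤
      (ball x₀ (2 * R)).indicator (fun y => Real.sqrt (frobeniusNormSq (fderiv ℝ w y))) x +
        (2 / R) * (ball x₀ (2 * R)).indicator (fun y => ‖w y‖) x := by
  have hφd : Differentiable ℝ φ := hφ.1.differentiable (by simp)
  rw [fderiv_fun_smul (hφd x) (hw x)]
  refine (sqrt_frobeniusNormSq_add_le _ _).trans (add_le_add ?_ ?_)
  · -- `√|φ(x)•Dw(x)|²_F = |φ(x)|·√|Dw(x)|²_F`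
    rw [frobeniusNormSq_smul_left, Real.sqrt_mul (sq_nonneg _), Real.sqrt_sq_eq_abs]
    by_cases hx : x ∈ ball x₀ (2 * R)
    · rw [indicator_of_mem hx]
      have h1 : |φ x| ≤ 1 := abs_le.2 ⟨by linarith [(hφ.2.2.2.1 x).1], (hφ.2.2.2.1 x).2⟩
      calc |φ x| * Real.sqrt (frobeniusNormSq (fderiv ℝ w x))
          ≤ 1 * Real.sqrt (frobeniusNormSq (fderiv ℝ w x)) :=
            mul_le_mul_of_nonneg_right h1 (Real.sqrt_nonneg _)
        _ = _ := one_mul _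
    · rw [indicator_of_notMem hx, hφ.2.2.1 x hx, abs_zero, zero_mul]
  · refine (sqrt_frobeniusNormSq_smulRight_le _ _).trans ?_
    by_cases hx : x ∈ ball x₀ (2 * R)
    · rw [indicator_of_mem hx]
      exact mul_le_mul_of_nonneg_right (hφ.2.2.2.2 x) (norm_nonneg _)
    · rw [indicator_of_notMem hx, fderiv_cutoff_eq_zero hφ hx, norm_zero, zero_mul, mul_zero]

/-- **Step 3, expansion clause — p. 2 l. 29–32 «‖∇v‖_{L²} ≤ ‖∇u‖_{L²(B_{2R})} + (2/R)‖u‖_{L²(B_{2R})}» is TRUE as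
typed** (D-0026 discharge): the pointwise expansion `|∇(φu)|_F ≤ 𝟙_{B_{2R}}|∇u|_F + (2/R)𝟙_{B_{2R}}|u|`
(product rule, the Hilbert–Schmidt triangle inequality, `|ϕ| ≤ 1`, `|∇ϕ| ≤ 2/R`, `∇ϕ = 0` off `B_{2R}`)
followed by Minkowski's inequality in `L²(ℝ³)` (`ENNReal.lintegral_Lp_add_le`); the two local integrals are
finite for a datum (`u, Du ∈ L²`). SUPPORT binder `_h3x` of `claimH_of_steps` (unconsumed): no token, no class
moves. [cite: Alneel2026, Step 3 p.2 l.29–32] -/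
theorem step3_expand_holds : Step3_expand := by
  intro w x₀ R φ hw hR hφ
  set S : Set E3 := ball x₀ (2 * R) with hS
  have hSm : MeasurableSet S := measurableSet_ball
  have hwd : Differentiable ℝ w := hw.1.differentiable (by simp)
  -- the two majorants, as `[0,∞]`-valued functions
  set F : E3 → ℝ≥0∞ := fun x => ENNReal.ofReal (S.indicator (fun y => Real.sqrt (frobeniusNormSq (fderiv ℝ w y))) x)
    with hF
  set G : E3 → ℝ≥0∞ := fun x => ENNReal.ofReal ((2 / R) * S.indicator (fun y => ‖w y‖) x) with hG
  -- measurability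
  have hcontX : Continuous fun y => frobeniusNormSq (fderiv ℝ w y) :=
    continuous_frobeniusNormSq_fderiv hw.1 (by norm_num)
  have hFm : AEMeasurable F volume := by
    refine ENNReal.measurable_ofReal.comp_aemeasurable ?_
    exact ((Real.continuous_sqrt.comp hcontX).measurable.indicator hSm).aemeasurable
  have hGm : AEMeasurable G volume := by
    refine ENNReal.measurable_ofReal.comp_aemeasurable ?_
    exact (((hw.1.continuous.norm).measurable.indicator hSm).const_mul _).aemeasurable
  -- the squares of the majorants integrate to the two local quantities
  have hF2 : ∫⁻ x, F x ^ (2 : ℝ) = ∫⁻ y in S, ENNReal.ofReal (frobeniusNormSq (fderiv ℝ w y)) := by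
    rw [← lintegral_indicator hSm]
    refine lintegral_congr fun x => ?_
    rw [ENNReal.rpow_two]
    by_cases hx : x ∈ S
    · rw [hF]; dsimp only
      rw [indicator_of_mem hx, indicator_of_mem hx, ← ENNReal.ofReal_pow (Real.sqrt_nonneg _),
        Real.sq_sqrt (frobeniusNormSq_nonneg _)]
    · rw [hF]; dsimp only
      rw [indicator_of_notMem hx, indicator_of_notMem hx, ENNReal.ofReal_zero, zero_pow two_ne_zero]
  have hG2 : ∫⁻ x, G x ^ (2 : ℝ) = ENNReal.ofReal (2 / R) ^ 2 * locEnergy w x₀ (2 * R) := by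
    rw [locEnergy, ← hS, ← lintegral_indicator hSm, ← lintegral_const_mul' _ _ (by simp)]
    refine lintegral_congr fun x => ?_
    rw [ENNReal.rpow_two]
    by_cases hx : x ∈ S
    · rw [hG]; dsimp only
      rw [indicator_of_mem hx, indicator_of_mem hx, ← ENNReal.ofReal_pow (by positivity), mul_pow,
        ENNReal.ofReal_mul (sq_nonneg _), ENNReal.ofReal_pow (by positivity), ← ofReal_norm,
        ENNReal.ofReal_pow (norm_nonneg _)]
    · rw [hG]; dsimp only
      rw [indicator_of_notMem hx, indicator_of_notMem hx, mul_zero, ENNReal.ofReal_zero,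
        zero_pow two_ne_zero, mul_zero]
  -- finiteness of the two local quantities for a datum
  have hXfin : ∫⁻ y in S, ENNReal.ofReal (frobeniusNormSq (fderiv ℝ w y)) < ⊤ := by
    refine lt_of_le_of_lt (lintegral_mono' Measure.restrict_le_self le_rfl) ?_
    refine lt_of_le_of_lt (lintegral_mono fun x => ofReal_frobeniusNormSq_le (fderiv ℝ w x)) ?_
    rw [lintegral_const_mul' _ _ (by norm_num)]
    refine ENNReal.mul_lt_top (by norm_num) ?_
    refine lt_of_le_of_lt (le_of_eq (lintegral_congr fun x => ?_)) (hw.2.2 1)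
    rw [← ofReal_norm, ← norm_iteratedFDeriv_one (𝕜 := ℝ) (f := w), ofReal_norm]
  have hEfin : locEnergy w x₀ (2 * R) < ⊤ := by
    rw [locEnergy]
    refine lt_of_le_of_lt (lintegral_mono' Measure.restrict_le_self le_rfl) ?_
    refine lt_of_le_of_lt (le_of_eq (lintegral_congr fun x => ?_)) (hw.2.2 0)
    rw [← ofReal_norm, ← norm_iteratedFDeriv_zero (𝕜 := ℝ) (f := w), ofReal_norm]
  -- Minkowski in `L²`
  have hMink := ENNReal.lintegral_Lp_add_le hFm hGm (p := 2) (by norm_num)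
  -- the integrand is dominated by `(F + G)²`
  have hdom : ∫⁻ x, ENNReal.ofReal (frobeniusNormSq (fderiv ℝ (fun y => φ y • w y) x)) ≤
      ∫⁻ x, (F + G) x ^ (2 : ℝ) := by
    refine lintegral_mono fun x => ?_
    rw [ENNReal.rpow_two, Pi.add_apply, hF, hG]
    dsimp only
    rw [← ENNReal.ofReal_add (indicator_nonneg (fun y _ => Real.sqrt_nonneg _) x)
      (mul_nonneg (by positivity) (indicator_nonneg (fun y _ => norm_nonneg _) x)),
      ← ENNReal.ofReal_pow (add_nonneg (indicator_nonneg (fun y _ => Real.sqrt_nonneg _) x)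
      (mul_nonneg (by positivity) (indicator_nonneg (fun y _ => norm_nonneg _) x)))]
    refine ENNReal.ofReal_le_ofReal ?_
    rw [← Real.sq_sqrt (frobeniusNormSq_nonneg (fderiv ℝ (fun y => φ y • w y) x))]
    exact pow_le_pow_left₀ (Real.sqrt_nonneg _) (sqrt_frobeniusNormSq_fderiv_smul_le hwd hφ x) 2
  -- the Bochner integral on the left: either not integrable (then `0`) or `toReal` of the lower integral
  by_cases hint : Integrable (fun x => frobeniusNormSq (fderiv ℝ (fun y => φ y • w y) x)) volume
  swap
  · rw [integral_undef hint, Real.sqrt_zero]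
    exact add_nonneg (Real.sqrt_nonneg _) (mul_nonneg (by positivity) (Real.sqrt_nonneg _))
  rw [integral_eq_lintegral_of_nonneg_ae (Eventually.of_forall fun x => frobeniusNormSq_nonneg _)
    hint.aestronglyMeasurable]
  -- pass to `[0,∞]` with exponent `1/2`
  have hhalf : ∀ a : ℝ≥0∞, Real.sqrt a.toReal = (a ^ (1 / 2 : ℝ)).toReal := fun a => by
    rw [Real.sqrt_eq_rpow, ← ENNReal.toReal_rpow]
  have hP : (∫⁻ x, ENNReal.ofReal (frobeniusNormSq (fderiv ℝ (fun y => φ y • w y) x))) ^ (1 / 2 : ℝ) ≤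
      (∫⁻ y in S, ENNReal.ofReal (frobeniusNormSq (fderiv ℝ w y))) ^ (1 / 2 : ℝ) +
        ENNReal.ofReal (2 / R) * locEnergy w x₀ (2 * R) ^ (1 / 2 : ℝ) := by
    calc (∫⁻ x, ENNReal.ofReal (frobeniusNormSq (fderiv ℝ (fun y => φ y • w y) x))) ^ (1 / 2 : ℝ)
        ≤ (∫⁻ x, (F + G) x ^ (2 : ℝ)) ^ (1 / 2 : ℝ) := by gcongr
      _ ≤ (∫⁻ x, F x ^ (2 : ℝ)) ^ (1 / 2 : ℝ) + (∫⁻ x, G x ^ (2 : ℝ)) ^ (1 / 2 : ℝ) := hMink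
      _ = _ := by
          rw [hF2, hG2, ENNReal.mul_rpow_of_nonneg _ _ (by norm_num : (0 : ℝ) ≤ 1 / 2),
            ← ENNReal.rpow_natCast, ← ENNReal.rpow_mul]
          norm_num
  -- back to real numbers
  have hPfin : (∫⁻ y in S, ENNReal.ofReal (frobeniusNormSq (fderiv ℝ w y))) ^ (1 / 2 : ℝ) ≠ ⊤ :=
    ENNReal.rpow_ne_top_of_nonneg (by norm_num) hXfin.ne
  have hEfin' : ENNReal.ofReal (2 / R) * locEnergy w x₀ (2 * R) ^ (1 / 2 : ℝ) ≠ ⊤ :=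
    ENNReal.mul_ne_top ENNReal.ofReal_ne_top (ENNReal.rpow_ne_top_of_nonneg (by norm_num) hEfin.ne)
  have := ENNReal.toReal_mono (ENNReal.add_ne_top.2 ⟨hPfin, hEfin'⟩) hP
  rw [ENNReal.toReal_add hPfin hEfin', ENNReal.toReal_mul, ENNReal.toReal_ofReal (by positivity)] at this
  rw [hhalf, locX, hhalf, hhalf]
  exact this

end Step3ExpandDischarge

section Step0Discharge

/-! ### Step 0 (the blow-up alternative) discharged (rev 5, typist-3 g7; D-0026 records-grade)

APPEND-ONLY: lines 1–1184 of rev 4 (p539784) are byte-identical; no keyed decl is touched (head of record #145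
`Step_P3tail`, RECORDED face `Step6_display`). `Step0_dichotomy` is the CONSUMED TRUE-type binder `h0` of
`claim_of_steps`; with rev 4 and this section every TRUE-type binder of the printed composition (`h0`, `h1`,
`_h3x`, `h4`) is discharged in-file and exactly the disputed faces (`h2`, `h6`, `h7`, `htail`) remain as
hypotheses. No token and no class moves.

WHAT THIS IS NOT: not a claim about NS regularity or blow-up; not a claim about any author beyond the typed
locator. -/


/-- Along a class solution on `[0,T)`, the `H¹` size `∫|u(s)|² + ∫|∇u(s)|²_F` of the slice at `s ∈ [0,T)` is
at most `2E₀ + X(s)` (energy non-increase, Step 1). [cite: Alneel2026, Step 1 (4) p.2 l.7–14] -/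
private theorem h1Size_le {ν T : ℝ} (hν : 0 < ν) (hT : 0 < T) {v₀ : E3 → E3} {u : ℝ → E3 → E3}
    {p : ℝ → E3 → ℝ} (hsol : IsLocalSolution ν T v₀ u p) {s : ℝ} (hs : s ∈ Ico 0 T) :
    (∫⁻ x, ‖u s x‖ₑ ^ 2) + XeF (u s) ≤ ENNReal.ofReal (2 * energyF v₀ + XF (u s)) := by
  -- finiteness of the two pieces (Sobolev bounds on `[0,s]`)
  obtain ⟨C₀, hC₀⟩ := hsol.sobolev s hs.2 0
  obtain ⟨C₁, hC₁⟩ := hsol.sobolev s hs.2 1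
  have h0fin : ∫⁻ x, ‖u s x‖ₑ ^ 2 < ⊤ := by
    refine lt_of_le_of_lt (le_of_eq (lintegral_congr fun x => ?_)) ((hC₀ s ⟨hs.1, le_rfl⟩).trans_lt ENNReal.coe_lt_top)
    rw [← ofReal_norm, ← norm_iteratedFDeriv_zero (𝕜 := ℝ) (f := u s), ofReal_norm]
  have hXfin : XeF (u s) < ⊤ := by
    refine lt_of_le_of_lt (lintegral_mono fun x => ofReal_frobeniusNormSq_le (fderiv ℝ (u s) x)) ?_
    rw [lintegral_const_mul' _ _ (by norm_num)]
    refine ENNReal.mul_lt_top (by norm_num) ?_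
    refine lt_of_le_of_lt (le_of_eq (lintegral_congr fun x => ?_)) ((hC₁ s ⟨hs.1, le_rfl⟩).trans_lt ENNReal.coe_lt_top)
    rw [← ofReal_norm, ← norm_iteratedFDeriv_one (𝕜 := ℝ) (f := u s), ofReal_norm]
  -- energy non-increase from Step 1: `E(s) ≤ E(0) = E(v₀)`
  obtain ⟨-, hE⟩ := step1_energy_holds ν hν T hT v₀ u p hsol
  obtain ⟨hEq, -⟩ := hE s hs
  have hint : 0 ≤ ∫ r in (0:ℝ)..s, XF (u r) :=
    intervalIntegral.integral_nonneg hs.1 fun r _ => xF_nonneg _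
  have hEs : energyF (u s) ≤ energyF v₀ := by
    rw [← hsol.initial]; nlinarith [mul_nonneg hν.le hint]
  -- assemble
  have h0eq : ∫⁻ x, ‖u s x‖ₑ ^ 2 = ENNReal.ofReal (2 * energyF (u s)) := by
    rw [energyF, ← mul_assoc, show (2:ℝ) * (1/2) = 1 by norm_num, one_mul, ENNReal.ofReal_toReal h0fin.ne]
  have hXeq : XeF (u s) = ENNReal.ofReal (XF (u s)) := by rw [XF, ENNReal.ofReal_toReal hXfin.ne]
  rw [h0eq, hXeq, ← ENNReal.ofReal_add (by linarith [energyF_nonneg (u s)]) (xF_nonneg _)]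
  exact ENNReal.ofReal_le_ofReal (by linarith)

/-- **Step 0 holds — p. 3 l. 13–15**: for every `ν > 0` and every datum, either a global class solution exists or
there is a class solution on some `[0,T*)` along which `X(t) → +∞` as `t → T*⁻`. The blow-up alternative in the
Beale–Kato–Majda class (`exists_global_bkmClass_or_blowup`, Majda–Bertozzi Thm 3.6 / Cor 3.2) gives a maximal
class solution; if `X` did not tend to `+∞` there would be restart times `s` arbitrarily close to `T*` with
`X(s) ≤ M`, hence (energy non-increase) with `H¹` size `≤ 2E₀ + M`, and Tao's `H¹` local existence theorem
(`tao2011_smooth_local_existence_holds`, lifespan `cν³/((2E₀+M)²+1)` independent of `s`) restarts a class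
solution living past `T*`; uniqueness in the class (`MajdaBertozzi2002_uniquenessSobolev_holds`) glues it to
`u` (`HasSobolevExtensionPast.of_translate`) — contradicting maximality. CONSUMED binder h0 of `claim_of_steps`
(TRUE-type): records-grade, no token and no class moves. [cite: Alneel2026, Thm 3.1 proof p.3 l.13–15]
[cite: Leray1934, (3.17)] [cite: MajdaBertozzi2002, Thm. 3.6, Cor. 3.1, Cor. 3.2] [cite: Tao2011, Thm. 5.4] -/
theorem step0_dichotomy_holds : Step0_dichotomy := by
  intro ν hν v₀ hd
  rcases exists_global_bkmClass_or_blowup hν.le hd.1 hd.2.1 hd.2.2 with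
    ⟨u, p, hu, hu0, hB, -⟩ | ⟨Ts, hTs, u, p, hu, hu0, hreg, -, hmax, -, -⟩
  · exact Or.inl ⟨u, p, ⟨hu, hu0, hB⟩⟩
  refine Or.inr ⟨Ts, hTs, u, p, ⟨hu, hu0, hreg⟩, ?_⟩
  have hsol : IsLocalSolution ν Ts v₀ u p := ⟨hu, hu0, hreg⟩
  by_contra hX
  -- a level `M ≥ 0` visited by `X` at times arbitrarily close to `T*`
  obtain ⟨M₀, hM₀⟩ : ∃ M₀ : ℝ, ∃ᶠ t in 𝓝[<] Ts, ¬ M₀ ≤ XF (u t) := by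
    by_contra h
    push Not at h
    exact hX (tendsto_atTop.2 h)
  set M : ℝ := max M₀ 0 with hM
  have hM0 : 0 ≤ M := le_max_right _ _
  -- Tao's lifespan for `H¹` size `≤ A* = 2E₀ + M`
  obtain ⟨c, hc, htao⟩ := tao2011_smooth_local_existence_holds
  set A : ℝ := 2 * energyF v₀ + M with hA
  have hA0 : 0 ≤ A := by have := energyF_nonneg v₀; positivity
  set τ : ℝ := c * ν ^ 3 / (A ^ 2 + 1) with hτdef
  have hτ : 0 < τ := by positivity
  have hτc : A ^ 2 * τ ≤ c * ν ^ 3 := by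
    rw [hτdef, mul_div_assoc', div_le_iff₀ (by positivity)]
    nlinarith [sq_nonneg A, mul_pos hc (pow_pos hν 3)]
  -- a restart time `s ∈ [0,T*)` with `T* - s < τ` and `X(s) ≤ M`
  obtain ⟨s, hsX, hsI⟩ : ∃ s, ¬ M₀ ≤ XF (u s) ∧ s ∈ Ioo (max 0 (Ts - τ / 2)) Ts :=
    (hM₀.and_eventually (Ioo_mem_nhdsLT (max_lt hTs (by linarith)))).exists
  have hs0 : 0 ≤ s := (le_max_left _ _).trans hsI.1.le
  have hsT : s < Ts := hsI.2
  have hsS : s ∈ Ico 0 Ts := ⟨hs0, hsT⟩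
  have hTsτ : Ts - s < τ := by
    have : Ts - τ / 2 < s := (le_max_right _ _).trans_lt hsI.1
    linarith
  have hXs : XF (u s) ≤ M := (le_of_lt (not_le.1 hsX)).trans (le_max_left _ _)
  -- the restarted class solution from `u s` on `[0, τ]`
  have hregs : HasBoundedSobolevNormsOn (Icc 0 s) u := hreg s hsT
  have hsize : (∫⁻ x, ‖u s x‖ₑ ^ 2) + (∫⁻ x, ENNReal.ofReal (frobeniusNormSq (fderiv ℝ (u s) x))) ≤
      ENNReal.ofReal A := by
    refine (h1Size_le hν hTs hsol hsS).trans (ENNReal.ofReal_le_ofReal ?_)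
    rw [hA]; linarith
  obtain ⟨v, q, hv, hv0, hvB, -, -, -⟩ := htao hν hτ (hu.contDiff_velocity hsS) (hu.divFree s hsS)
    (fun n => by
      obtain ⟨C, hC⟩ := hregs n
      exact (hC s ⟨hs0, le_rfl⟩).trans_lt ENNReal.coe_lt_top)
    hA0 hsize hτc
  -- uniqueness on `[0, T* - s)`: `v = u (· + s)`
  have huniq : ∀ t ∈ Ico 0 (Ts - s), u (t + s) = v t := by
    intro t ht
    obtain ⟨ht0, htT⟩ := ht
    set S : ℝ := (t + (Ts - s)) / 2 with hS
    have htS : t ≤ S := by linarith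
    have hS' : S < Ts - s := by linarith
    have hSτ : S ≤ τ := by linarith
    have hS0 : 0 < S := by linarith
    have h1 : IsClassicalNSSolutionOn (Icc 0 S) ν 0 (fun r => u (r + s)) (fun r => p (r + s)) :=
      (hu.translate_Ico_zero hs0).mono (Icc_subset_Ico_right hS') (uniqueDiffOn_Icc hS0)
    have h2 : IsClassicalNSSolutionOn (Icc 0 S) ν 0 v q :=
      hv.mono (Icc_subset_Icc_right hSτ) (uniqueDiffOn_Icc hS0)
    have hB1 : HasBoundedSobolevNormsOn (Icc 0 S) (fun r => u (r + s)) := by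
      have h := hreg (S + s) (by linarith)
      intro n
      obtain ⟨C, hC⟩ := h n
      exact ⟨C, fun r hr => hC (r + s) ⟨by linarith [hr.1], by linarith [hr.2]⟩⟩
    have hB2 : HasBoundedSobolevNormsOn (Icc 0 S) v := hvB.mono (Icc_subset_Icc_right hSτ)
    have h0 : (fun r => u (r + s)) 0 = v 0 := by simp only [zero_add, hv0]
    exact MajdaBertozzi2002_uniquenessSobolev_holds hν.le hS0 h1 h2 hB1 hB2 h0 t ⟨ht0, htS⟩
  -- `v` continues the translate past `T* - s`, hence `u` continues past `T*`
  have hext : HasSobolevExtensionPast ν (fun t => u (t + s)) (Ts - s) :=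
    ⟨τ, hTsτ, v, q, hv.mono Ico_subset_Icc_self (uniqueDiffOn_Ico 0 τ),
      hvB.mono (Icc_subset_Icc_right hTsτ.le), fun t ht => (huniq t ht).symm⟩
  exact hmax (HasSobolevExtensionPast.of_translate hu hregs hs0 hsT hext)

/-- `Step0_dichotomy` — `_holds` alias of `step0_dichotomy_holds` above under the fact's exact name (appended
2026-08-28, D-0026 bookkeeping: the proof term is the existing theorem of this file; no statement,
definition or attribute is edited; no new named fact; the ledger's debt table listed the fact
unproved). [cite: Tao2011, Thm. 5.4] -/
theorem _root_.Literature.Claims.NS.Alneel2026.Step0_dichotomy_holds : Step0_dichotomy :=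
  _root_.Literature.Claims.NS.Alneel2026.step0_dichotomy_holds

end Step0Discharge

end Literature.Claims.NS.Alneel2026

end
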